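import Mathlib
import Literature.MathematicalPhysics.QuantumFieldTheory.Balaban1983to89.B6Elimination

/-!
# `Balaban1983to89.B6BondElimination` — the bond elimination `B = CB′` of the constraints `QB = 0` (B5 (1.11)) and
`B(Γ_{y,x}) = 0` (B5 (1.10)) at the use site (S5), pp. 249–250 of B6, EXHIBITED with kernel-checked range / ℓ¹ / norm
constants, the typed tree constraint PROVED equivalent to the printed axial gauge conditions, and the p. 250 sentence
*"C is a short-ranged operator … It gives us an exponential decay, and all the other properties, for the operator
(C*Δ_kC)⁻¹, hence for C^{(k)}_Λ also"* as a theorem modulo the named analytic leaves — for operators on an ARBITRARY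
sub-family of the variables (padding lemma), which was the typing obstacle of `…B6Elimination` remark (v) (cell
census: closes the located residual GAPS G-b06g3-1 left open by C-b06g3-1)

B6 = T. Bałaban, *Propagators and renormalization transformations for lattice gauge theories. II*, Commun. Math.
Phys. **96**, 223–250 (1984) [Balaban1984PropagatorsII] (held `paper:balaban1984-cmp96-propagators-rt-ii`; journal
page = PDF page + 222).  B5 = T. Bałaban, *Propagators and renormalization transformations for lattice gauge
theories. I*, Commun. Math. Phys. **95**, 17–40 (1984) [Balaban1984PropagatorsI] (held
`paper:balaban1984-cmp95-propagators-rt-i`; journal page = PDF page + 16).  [3] = T. Bałaban, *Regularity and decay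
of lattice Green's functions*, Commun. Math. Phys. **89**, 571–597 (1983) [Balaban1983RegularityDecay] = B4.
Every quotation below was read from the x2 page renders `b2b-balaban-ref1/pages/1984-cmp96-propagators-rt-II/
…-p002,-p027,-p028-x2.png` (B6 pp. 224, 249, 250) and `…/1984-cmp95-propagators-rt-I/…-p002,-p003-x2.png` (B5 pp. 18,
19), not from an OCR layer.  Neither `…B4`, `…B6`, `…B6FromB4` nor `…B6Elimination` is modified; this module imports
`…B6Elimination` (this unit, p177738) for the block geometry (`corner`, `block`) and, through it, `…B6FromB4` (unit
pv09-g2, p177133) for the engine (`engine_of_sect5Uniform`, `sandwich_decay`, `sandwich_lowerBound`, `sandwich_isSymm`).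

CITATION HEADER (lean-in-tree rule 2026-08-18).  WHAT IS PRINTED (verbatim).
* B5 (1.1) p. 18: *"A_{⟨x,x+εe_μ⟩} = A(x, x + εe_μ) = A_μ(x), x ∈ T_ε, μ = 1, …, d. (1.1)"* — a bond field is a vector
  valued function on the sites, d components per site; and *"We assume that A_b is defined for bonds b with arbitrary
  orientation and that A_{⟨x,x′⟩} = −A_{⟨x′,x⟩}."*
* B5 (1.6)–(1.7) p. 18: *"B(y) = {x ∈ T₁ : y_μ ≤ x_μ < y_μ + L, μ = 1, …, d}, y ∈ T_L^{(1)}. (1.6) In each block B(y) we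
  introduce a family of contours Γ_{y,x} connecting the points y and x: Γ_{y,x} = [y, (y₁, …, y_{d−1}, x_d)] ∪ … ∪
  [(y₁, …, y_μ, x_{μ+1}, …, x_d), (y₁, …, x_μ, x_{μ+1}, …, x_d)] ∪ … ∪ [(y₁, x₂, …, x_d), x], (1.7) where [x₁, x₂] is a
  line segment connecting points x₁, x₂. We consider Γ_{y,x}, and all other contours appearing in the paper, as
  oriented contours, with initial point y and final point x."*
* B5 p. 19: *"where A(Γ) = Σ_{b⊂Γ} A_b for arbitrary contour Γ, and x(c) denotes a point in the block B(c₊) obtained by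
  translation of x by the bond c, so if c = ⟨y, y + Le_μ⟩ then x(c) = x + Le_μ."*; *"we remove it by introducing
  Axial (Ax) gauge fixing conditions A(Γ_{y,x}) = 0, x ∈ B(y), x ≠ y, y ∈ T_L^{(1)}. If we denote δ_{Ax}(A) =
  ∏_{y∈T_L^{(1)}} ∏_{x∈B(y), x≠y} δ(A(Γ_{y,x})), (1.10) (QA)_c = Σ_{x∈B(c₋)} L^{−(d+1)}A([x, x(c)]), δ(B − QA) =
  ∏_{c⊂T_L^{(1)}} δ(B_c − (QA)_c), (1.11)"*.
* B6 p. 224 [PDF 2]: *"If Ω ⊂ T_η, then we denote by Ω also the set of bounds ⋃_{x∈Ω} st(x) = {bonds b ⊂ T_η: at least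
  one end-point of b belongs to Ω}."* (sic "bounds").
* B6 p. 249 [PDF 27]: *"Next let us consider the inequality (2.128) in Lemma 2.4 again. We will apply it in the following
  situation. Doing a k + 1 renormalization transformation we have to calculate an integral of the form const∫dBδ(QB)
  δ_{Ax}(B)e^{−½⟨B,Δ_kB⟩}F(B) (1.152) on the whole lattice T^{(k)}, or on a subset Λ ⊂ T^{(k)}. Using (2.118) and (2.128)
  we get ⟨B, Δ_kB⟩ ≥ (γ₀/12d²)L^{−d−1}‖B‖², or Δ_k ≥ (γ₀/12d²)L^{−d−1} (2.153) on the subspace of B satisfying: QB = 0,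
  B(Γ_{y,x}) = 0 for x ∈ B(y). Let us denote the covariance of the Gaussian integration in (2.152) by C^{(k)}, or by
  C^{(k)}_Λ, hence ∫dB↾_Λ δ(QB)δ_{Ax}(B)e^{−½⟨B,Δ_kB⟩+⟨J,B⟩} = Z^{(k)}e^{½⟨J,C^{(k)}_ΛJ⟩}. (2.154) An easy way to get a
  useful representation for C^{(k)}_Λ is to get rid of the unnecessary variables in the integral above. We remove the
  variables B_b for b ⊂ Γ_{y,x} using the δ-functions δ_{Ax}(B). Next we remove the variables B_{b₀}, where b₀ is a
  bond belonging to B(c) for some c ∈ Λ′, and contained in c, using the δ-functions δ((QB)(c)). If we denote the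
  remaining variables by B′, then we can write B = CB′, where C is a linear"* (the display number "(1.152)" sic) —
  continued on p. 250 [PDF 28]: *"operator, and we have (the left-hand side of (2.154)) = (L^d)^{|Λ′|}∫dB′
  e^{−½⟨B′,C*Δ_kCB′⟩+⟨C*J,B′⟩} = (L^d)^{|Λ′|}Z′^{(k)}e^{½⟨C*J,(C*Δ_kC)⁻¹C*J⟩}, (2.155) hence C^{(k)}_Λ = C(C*Δ_kC)⁻¹C*.
  (2.156) By the definition of C we have of course that CB′ = 0 outside Λ, QCB′ = 0, (CB′)(Γ_{y,x}) = 0, x ∈ B(y),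
  y ∈ Λ′, for arbitrary B′. The inequality (2.153) implies ⟨B′, C*Δ_kCB′⟩ ≥ (γ₀/12d²)L^{−d−1}‖CB′‖² ≥ γ′₀‖B′‖²,
  (2.157) where γ′₀ = (γ₀/12d²)L^{−d−1}. C is a short-ranged operator, so C*Δ_kC has the same exponential decay as
  Δ_k. Now we may apply the theory developed in Sect. 5 of [3] on unit lattice operators. It gives us an exponential
  decay, and all the other properties, for the operator (C*Δ_kC)⁻¹, hence for C^{(k)}_Λ also."*

THE READING (a labelled modelling step, cell DIVERGENCE D-b06.11; nothing of it is a cited fact).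
(a) Variables.  The field B of (2.152)–(2.154) is a bond field *"on the whole lattice T^{(k)}, or on a subset
Λ ⊂ T^{(k)}"*, to which *"the theory … on unit lattice operators"* is applied; by B5 (1.1) a bond field is the vector
valued site function (A_μ(x))_μ, so the variables B↾Λ are typed as `B : B4.Idx Ω d → ℝ` — Ω ⊂ Z^d finite, the set of
STARTING points, fibre R^d (the index type on which `…B4` types the theorem of [3]); B is extended by 0 to all other
unit bonds (`extB`; p. 250 *"CB′ = 0 outside Λ"*).  The print attaches a bond to a region by its end-points (p. 224,
quoted) — typing remark (ii).
(b) Constraints.  A bond c = ⟨y, y + Le_μ⟩ of the L-lattice is recorded as the pair (y, μ); (QB)(c) is (1.11) read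
literally — `avgQ L B (y, μ) = Σ_{x∈B(y)} L^{−(d+1)} Σ_{s=0}^{L−1} B_{⟨x+se_μ, x+(s+1)e_μ⟩}`, A([x, x + Le_μ]) being the
sum over the L unit bonds of the straight contour — imposed for c in a finite set K (print: c ∈ Λ′); the axial gauge
conditions are imposed for the blocks of the points of a finite set Y ⊂ LZ^d (print: y ∈ Λ′) and typed as "B_b = 0 for
every bond b of the tree Γ_y = ⋃_{x∈B(y)} Γ_{y,x}" (`IsTree`) — PROVED equivalent to the printed family "B(Γ_{y,x}) =
0, x ∈ B(y), x ≠ y" (`contour` = the unit bonds of (1.7); `axial_iff`, `tree_iff_axial`, via Γ_{y,z+e_μ} = Γ_{y,z} ∪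
{⟨z, z + e_μ⟩} along the tree, `contour_add_unitVec`), which is the linear equivalence behind p. 249's *"We remove
the variables B_b for b ⊂ Γ_{y,x} using the δ-functions δ_{Ax}(B)"*.  (K, Y) are ARBITRARY admissible data
(`Admissible`: c₋ ∈ LZ^d and the pivot of c starts in Ω), which contains the print's case.
(c) Pivots.  *"b₀ is a bond belonging to B(c) for some c ∈ Λ′, and contained in c"* is taken to be the LAST unit bond
⟨y + (L−1)e_μ, y + Le_μ⟩ of c (`pivSite`): its coefficient in L^{d+1}(QB)(c) is L (`mult_pivSite`), it occurs in no
other constraint of the L-lattice (`eq_of_mult_pivSite_ne_zero`) and on no tree (`not_isTree_of_piv`); another bond of c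
would give another parametrization of the same subspace and the same covariance.
(d) C.  Following the two sentences of p. 249 word for word: a remaining variable is copied, a tree bond is set to 0,
and B_{b₀(c)} is solved from (QB)(c) = 0, B_{b₀(c)} = −L^{−1} Σ_{b′} mult_c(b′) B′_{b′} (`elimB`; `mult` = the
multiplicity of a unit bond in the double sum (1.11)).  The covariance is C(C*Δ_kC)⁻¹C* by (2.155)–(2.156): this is
`SubReduction.cov` BY DEFINITION (C* ↦ Cᵀ; the inverse = the matrix inverse on the remaining variables, a genuine
inverse by `isUnit_det_of_lower`); the module adds that C is a linear BIJECTION of the remaining coordinates onto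
{(QB)(c) = 0, c ∈ K; B = 0 on the trees of Y} (`avgQ_elimB_mulVec`, `elimB_mulVec_tree`, `elimB_restrB`,
`elimB_mulVec_free`), which is what the change of variables (2.155) uses.
(e) T^{(k)} ↦ Z^d (as in `…B4`, D-b04.5, and `…B6Elimination` (i)); "|b − b′|" ↦ the sup-distance of the starting
points, as in `…B4`.

WHAT IS KERNEL-CHECKED HERE (finite combinatorics of blocks and bonds + matrix arithmetic; imports `Mathlib`,
`…B6Elimination`):
(1) §1–§2, the typing obstacle of `…B6Elimination` remark (v) dissolved: for an operator M on an arbitrary sub-family F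
    of a finite index set, the block-diagonal extension `pad F M γ` (γ·1 on the removed variables) satisfies `pad_mul`,
    `pad_inv` ((pad M γ)⁻¹ = pad M⁻¹ γ⁻¹), `pad_quadForm`, `pad_lower`, `pad_decay`, `hyp56_pad` (M symmetric, ≥ γ, with
    entry decay (c, δ) ⇒ `B4.Hyp56 Ω (pad F M γ) γ (c + γ) δ`); hence `subReductions_uniform`: from
    `B4.Sect5ThmUniform d N`, ONE (c, δ) for ALL instances `SubReduction` (region Ω, kept sub-family F ⊆ Ω × Fin N,
    operator Δ, matrix C) with the printed-shape inputs `SubReduction.Printed γ c₀ δ₀ r m` (Δ symmetric with entry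
    decay (c₀, δ₀); γ‖Cw‖² ≤ ⟨Cw, ΔCw⟩; ‖w‖² ≤ ‖Cw‖²; range ≤ r; ℓ¹ column/row sums ≤ m): |C(CᵀΔC)⁻¹Cᵀ(p, q)| ≤
    c·e^{−δ|p−q|} with c = c₁e^{2δ₁r}m², δ = δ₁, (c₁, δ₁) from [3] at (γ, c₀ + γ, δ₀);
(2) §3, the bond geometry of (1.11): `mult_pivSite` (= L), `eq_of_mult_pivSite_ne_zero` / `cOf_eq_of_mult_ne_zero` (a
    pivot occurs in no other constraint of the L-lattice), `dist_le_of_mult_ne_zero` (≤ L − 1), `sum_mult_le_L` (a unit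
    bond occurs in all constraints of the L-lattice together with multiplicity ≤ L — the blocks are disjoint),
    `sum_mult_le` (total multiplicity of one constraint ≤ L^d·L), `avgQ_eq_sum_mult` ((1.11) as a weighted sum over the
    variables);
(3) §3b, fidelity of the tree constraint: `contour_add_unitVec` (Γ_{y,z+e_μ} = Γ_{y,z} ∪ {⟨z, z+e_μ⟩}), `contour_self`,
    `axial_iff` ((1.10) for the block of y ⇔ A_b = 0 on Γ_y), `isTree_iff`, `tree_iff_axial` (for Y ⊂ LZ^d with blocks
    in Ω: "B = 0 on `IsTree`" ⇔ the printed conditions for all y ∈ Y);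
(4) §4–§5, the elimination: `avgQ_elimB_mulVec` (*"QCB′ = 0"*), `elimB_mulVec_tree` (*"(CB′)(Γ_{y,x}) = 0"*),
    `elimB_restrB` (C(B↾remaining) = B on the constrained subspace), `elimB_mulVec_free` ((CB′)↾remaining = B′);
    `elimB_iso` (‖B′‖² ≤ ‖CB′‖², the second inequality of (2.157)), `elimB_range` (C(b, b′) ≠ 0 ⇒ |b₋ − b′₋|_∞ ≤
    L − 1), `elimB_col` (Σ_b |C(b, b′)| ≤ 2), `elimB_row` (Σ_{b′} |C(b, b′)| ≤ L^d) — the three numbers behind *"C is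
    a short-ranged operator"*, which the print does not display; `bondReduction_printed`: admissible (K, Y), Δ
    symmetric with entry decay (c₀, δ₀) and (2.153) with constant γ on the constrained subspace give
    `Printed γ c₀ δ₀ (L − 1) (L^d + 1)`; hence
(5) `bond250_uniform`: from `B4.Sect5ThmUniform d d` there are ONE c and ONE δ — chosen after (d, L, γ, c₀, δ₀) and
    BEFORE the region, the constraint data and the operator — such that for EVERY finite Ω ⊂ Z^d, EVERY admissible
    (K, Y) and EVERY symmetric Δ on the bond variables of Ω with |Δ(b, b′)| ≤ c₀e^{−δ₀|b₋−b′₋|} and (2.153) (constant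
    γ) on {(QB)(c) = 0, c ∈ K; B = 0 on the trees of Y}, the covariance (2.156) satisfies |C^{(k)}_Λ(b, b′)| ≤
    c·e^{−δ|b₋−b′₋|} — the k- and Λ-independence as the quantifier order ∃(c, δ) ∀(Ω, K, Y, Δ_k).
WHAT REMAINS A NAMED HYPOTHESIS (nothing of it is asserted here): `B4.Sect5ThmUniform d d` itself ([3] Sect. 5,
uniform reading, census C-B4-3); per k, the printed-shape inputs on Δ = Δ_k — the lower bound (2.153) with γ =
(γ₀/12d²)L^{−d−1}, which B6 obtains *"Using (2.118) and (2.128)"* (Lemma 2.4; the cell's Lemma 2.4 records apply),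
typed `LowerOnConstrained`; the entry decay of Δ_k with (c₀, δ₀) independent of k, presupposed by *"C*Δ_kC has the
same exponential decay as Δ_k"* and not displayed on these pages; and the symmetry of Δ_k.  The constant of the
conclusion is c₁e^{2δ₁(L−1)}(L^d + 1)² with (c₁, δ₁) the constants of [3] at (γ, c₀ + γ, δ₀): explicit in
(d, L, γ, c₀, δ₀).

TYPING REMARKS (DIVERGENCE D-b06.11).  (i) T^{(k)} ↦ Z^d, Ω finite; torus wrapping not typed (as `…B6Elimination`
(i)).  (ii) Variables = unit bonds indexed by their starting point in Ω (B5 (1.1)); B6 p. 224 attaches a bond to a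
region when *"at least one end-point of b belongs to Ω"* — for a union of blocks the two conventions differ by the
bonds entering Λ from outside; the theorem is stated for every finite Ω and all admissible data, and the print's
variable set is the case "Ω = the starting points of the bonds of Λ" up to those boundary bonds, whose treatment
((2.154) integrates dB↾_Λ) the two pages do not spell out.  (iii) C* ↦ Cᵀ (real matrices).  (iv) Directions are
indexed by `Fin d` = {0, …, d − 1} for the print's μ = 1, …, d; (1.7)'s "coordinates before μ still at y, after μ
already at x" is order-preserving under the shift.  (v) (K, Y) general: the print's K = the bonds of Λ′, Y = the
points of Λ′; `Admissible` asks only what the construction uses (c₋ ∈ LZ^d, b₀(c) a variable), `tree_iff_axial`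
additionally that the blocks of Y lie in Ω, as B(Λ′) ⊂ Λ.  (vi) The factor (L^d)^{|Λ′|} of (2.155) (the Jacobian of
the δ-functions) is not typed — it does not enter C^{(k)}_Λ.  (vii) The remaining-variable set F = `freeB` is a
`Finset` of Ω × Fin d coerced to a type; `SubReduction` replaces the product-form Ω′ × Fin N′ of `B6FromB4.Reduction`
by such an F, and §1's padding is what lets `B4.Sect5ThmUniform` (typed on Ω × Fin N) act on operators living on F.

Value = kernel-checked construction closing a located residual at the level of the implication + the residual
analytic leaves named as hypotheses, NOT summit progress.  Cell pub-balaban, unit `b2b-balaban-b06-g3` (paper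
sub-cell B06, gen 3); census rows GAPS C-b06g3-2 (closes G-b06g3-1 = `…B6Elimination` typing remark (v)),
DIVERGENCE D-b06.11.
-/

open Finset Matrix

namespace Literature.MathematicalPhysics.QuantumFieldTheory.Balaban1983to89.B6BondElimination

noncomputable section

/-! ## §1  Padding: an operator on a sub-family `F` of the variables, extended by γ·1 on the removed variables -/

section Padding

variable {ι : Type} [DecidableEq ι] (F : Finset ι)

/-- The padded operator: `M` on the kept variables F, γ times the identity on the removed ones, no coupling.
(Block-diagonal extension used to apply the theorem of [3], which is typed on product index sets Ω × Fin N, to an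
operator living on an arbitrary sub-family F ⊆ Ω × Fin N of the variables.) [folklore] -/
def pad (M : Matrix F F ℝ) (γ : ℝ) : Matrix ι ι ℝ :=
  Matrix.of fun p q => if hp : p ∈ F then (if hq : q ∈ F then M ⟨p, hp⟩ ⟨q, hq⟩ else 0)
    else (if p = q then γ else 0)

variable {F}

/-- Entries on F × F. [folklore] -/
theorem pad_mem_mem (M : Matrix F F ℝ) (γ : ℝ) {p q : ι} (hp : p ∈ F) (hq : q ∈ F) :
    pad F M γ p q = M ⟨p, hp⟩ ⟨q, hq⟩ := by
  simp [pad, hp, hq]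

/-- Entries on F × Fᶜ vanish. [folklore] -/
theorem pad_mem_not (M : Matrix F F ℝ) (γ : ℝ) {p q : ι} (hp : p ∈ F) (hq : q ∉ F) :
    pad F M γ p q = 0 := by
  simp [pad, hp, hq]

/-- Rows outside F: γ on the diagonal. [folklore] -/
theorem pad_not (M : Matrix F F ℝ) (γ : ℝ) {p : ι} (hp : p ∉ F) (q : ι) :
    pad F M γ p q = if p = q then γ else 0 := by
  simp [pad, hp]

/-- Entries at points of ↥F. [folklore] -/
theorem pad_coe (M : Matrix F F ℝ) (γ : ℝ) (f f' : F) : pad F M γ f f' = M f f' := by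
  rw [pad_mem_mem M γ f.2 f'.2]

/-- Padding of the identity is the identity. [folklore] -/
theorem pad_one : pad F (1 : Matrix F F ℝ) 1 = (1 : Matrix ι ι ℝ) := by
  ext p q
  by_cases hp : p ∈ F
  · by_cases hq : q ∈ F
    · rw [pad_mem_mem _ _ hp hq, Matrix.one_apply, Matrix.one_apply]
      simp only [Subtype.mk.injEq]
    · rw [pad_mem_not _ _ hp hq, Matrix.one_apply, if_neg]
      rintro rfl
      exact hq hp
  · rw [pad_not _ _ hp, Matrix.one_apply]

/-- Padding preserves symmetry. [folklore] -/
theorem pad_isSymm {M : Matrix F F ℝ} (hM : M.IsSymm) (γ : ℝ) : (pad F M γ).IsSymm := by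
  ext p q
  rw [Matrix.transpose_apply]
  by_cases hp : p ∈ F
  · by_cases hq : q ∈ F
    · rw [pad_mem_mem _ _ hp hq, pad_mem_mem _ _ hq hp]
      exact hM.apply _ _
    · rw [pad_mem_not _ _ hp hq, pad_not _ _ hq, if_neg]
      rintro rfl
      exact hq hp
  · by_cases hq : q ∈ F
    · rw [pad_not _ _ hp, pad_mem_not _ _ hq hp, if_neg]
      rintro rfl
      exact hp hq
    · rw [pad_not _ _ hp, pad_not _ _ hq]
      split_ifs with h1 h2 h2
      · rfl
      · exact absurd h1.symm h2
      · exact absurd h2.symm h1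
      · rfl

/-- Entrywise decay of the padded operator (the diagonal padding costs + γ in the constant). [folklore] -/
theorem pad_decay {X : Type} [PseudoMetricSpace X] (pos : ι → X) {M : Matrix F F ℝ} {c δ γ : ℝ}
    (hc : 0 ≤ c) (hγ : 0 ≤ γ)
    (hM : ∀ f f' : F, |M f f'| ≤ c * Real.exp (-(δ * dist (pos f) (pos f')))) :
    ∀ p q, |pad F M γ p q| ≤ (c + γ) * Real.exp (-(δ * dist (pos p) (pos q))) := by
  intro p q
  have he : 0 < Real.exp (-(δ * dist (pos p) (pos q))) := Real.exp_pos _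
  by_cases hp : p ∈ F
  · by_cases hq : q ∈ F
    · rw [pad_mem_mem _ _ hp hq]
      refine (hM ⟨p, hp⟩ ⟨q, hq⟩).trans ?_
      exact mul_le_mul_of_nonneg_right (by linarith) he.le
    · rw [pad_mem_not _ _ hp hq, abs_zero]
      positivity
  · rw [pad_not _ _ hp]
    split_ifs with h
    · subst h
      rw [dist_self, mul_zero, neg_zero, Real.exp_zero, mul_one, abs_of_nonneg hγ]
      linarith
    · rw [abs_zero]
      positivity

variable [Fintype ι]

/-- Σ over ι of a function supported on F, given through membership proofs, is the Σ over ↥F. [folklore] -/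
theorem sum_dite_mem (F : Finset ι) (g : F → ℝ) :
    ∑ u : ι, (if hu : u ∈ F then g ⟨u, hu⟩ else 0) = ∑ f : F, g f := by
  rw [← Finset.sum_subset (Finset.subset_univ F) (fun u _ hu => dif_neg hu), ← Finset.sum_coe_sort F]
  exact Finset.sum_congr rfl fun f _ => by rw [dif_pos f.2]

/-- Padding is multiplicative. [folklore] -/
theorem pad_mul (M M' : Matrix F F ℝ) (γ γ' : ℝ) :
    pad F M γ * pad F M' γ' = pad F (M * M') (γ * γ') := by
  ext p q
  rw [Matrix.mul_apply]
  by_cases hp : p ∈ F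
  · have h1 : ∀ u, pad F M γ p u * pad F M' γ' u q =
        if hu : u ∈ F then M ⟨p, hp⟩ ⟨u, hu⟩ * pad F M' γ' u q else 0 := by
      intro u
      by_cases hu : u ∈ F
      · rw [dif_pos hu, pad_mem_mem M γ hp hu]
      · rw [dif_neg hu, pad_mem_not M γ hp hu, zero_mul]
    rw [Finset.sum_congr rfl fun u _ => h1 u, sum_dite_mem F (fun f => M ⟨p, hp⟩ f * pad F M' γ' f q)]
    by_cases hq : q ∈ F
    · rw [pad_mem_mem _ _ hp hq, Matrix.mul_apply]
      refine Finset.sum_congr rfl fun f _ => ?_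
      rw [pad_mem_mem M' γ' f.2 hq]
    · rw [pad_mem_not _ _ hp hq]
      refine Finset.sum_eq_zero fun f _ => ?_
      rw [pad_mem_not M' γ' f.2 hq, mul_zero]
  · have h1 : ∀ u, pad F M γ p u * pad F M' γ' u q = if p = u then γ * pad F M' γ' u q else 0 := by
      intro u
      rw [pad_not M γ hp]
      split_ifs <;> simp
    rw [Finset.sum_congr rfl fun u _ => h1 u, Finset.sum_ite_eq, if_pos (Finset.mem_univ p),
      pad_not M' γ' hp, pad_not (M * M') (γ * γ') hp]
    split_ifs <;> ring

/-- The inverse of a padded invertible operator is the padding of the inverse (block-diagonal inversion).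
[folklore] -/
theorem pad_inv (M : Matrix F F ℝ) (hM : IsUnit M.det) {γ : ℝ} (hγ : γ ≠ 0) :
    (pad F M γ)⁻¹ = pad F M⁻¹ γ⁻¹ := by
  apply Matrix.inv_eq_right_inv
  rw [pad_mul, Matrix.mul_nonsing_inv _ hM, mul_inv_cancel₀ hγ, pad_one]

/-- The padded operator applied to a vector, at a kept variable. [folklore] -/
theorem pad_mulVec_mem (M : Matrix F F ℝ) (γ : ℝ) (v : ι → ℝ) {p : ι} (hp : p ∈ F) :
    (pad F M γ *ᵥ v) p = (M *ᵥ fun f => v f) ⟨p, hp⟩ := by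
  simp only [Matrix.mulVec, dotProduct]
  have h1 : ∀ q, pad F M γ p q * v q = if hq : q ∈ F then M ⟨p, hp⟩ ⟨q, hq⟩ * v q else 0 := by
    intro q
    by_cases hq : q ∈ F
    · rw [dif_pos hq, pad_mem_mem _ _ hp hq]
    · rw [dif_neg hq, pad_mem_not _ _ hp hq, zero_mul]
  rw [Finset.sum_congr rfl fun q _ => h1 q]
  exact sum_dite_mem F (fun f => M ⟨p, hp⟩ f * v f)

/-- The padded operator applied to a vector, at a removed variable. [folklore] -/
theorem pad_mulVec_not (M : Matrix F F ℝ) (γ : ℝ) (v : ι → ℝ) {p : ι} (hp : p ∉ F) :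
    (pad F M γ *ᵥ v) p = γ * v p := by
  simp only [Matrix.mulVec, dotProduct]
  have h1 : ∀ q, pad F M γ p q * v q = if p = q then γ * v q else 0 := by
    intro q
    rw [pad_not _ _ hp]
    split_ifs <;> simp
  rw [Finset.sum_congr rfl fun q _ => h1 q, Finset.sum_ite_eq, if_pos (Finset.mem_univ _)]

/-- The quadratic form of the padded operator splits. [folklore] -/
theorem pad_quadForm (M : Matrix F F ℝ) (γ : ℝ) (v : ι → ℝ) :
    ∑ p, v p * (pad F M γ *ᵥ v) p =
      (∑ f : F, v f * (M *ᵥ fun f => v f) f) + γ * ∑ p ∈ Fᶜ, v p ^ 2 := by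
  rw [← Finset.sum_add_sum_compl F, ← Finset.sum_coe_sort F]
  congr 1
  · exact Finset.sum_congr rfl fun f _ => by rw [pad_mulVec_mem M γ v f.2]
  · rw [Finset.mul_sum]
    exact Finset.sum_congr rfl fun p hp => by
      rw [pad_mulVec_not M γ v (Finset.mem_compl.mp hp)]
      ring

/-- Lower bound of the padded operator from a lower bound of M and γ′ ≤ γ. [folklore] -/
theorem pad_lower {M : Matrix F F ℝ} {γ' γ : ℝ} (hγ' : γ' ≤ γ)
    (hM : ∀ w : F → ℝ, γ' * ∑ f, w f ^ 2 ≤ ∑ f, w f * (M *ᵥ w) f) (v : ι → ℝ) :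
    γ' * ∑ p, v p ^ 2 ≤ ∑ p, v p * (pad F M γ *ᵥ v) p := by
  rw [pad_quadForm, ← Finset.sum_add_sum_compl F (fun p => v p ^ 2), ← Finset.sum_coe_sort F, mul_add]
  apply add_le_add (hM fun f => v f)
  exact mul_le_mul_of_nonneg_right hγ' (Finset.sum_nonneg fun p _ => sq_nonneg _)

/-- A strictly positive lower bound of the quadratic form makes a (square, real) matrix invertible. [folklore] -/
theorem isUnit_det_of_lower {n : Type} [Fintype n] [DecidableEq n] {M : Matrix n n ℝ} {γ : ℝ} (hγ : 0 < γ)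
    (hl : ∀ w : n → ℝ, γ * ∑ k, w k ^ 2 ≤ ∑ k, w k * (M *ᵥ w) k) : IsUnit M.det := by
  rw [← Matrix.isUnit_iff_isUnit_det, ← Matrix.mulVec_injective_iff_isUnit]
  intro w w' h
  have h0 : M *ᵥ (w - w') = 0 := by rw [Matrix.mulVec_sub, h, sub_self]
  have h1 := hl (w - w')
  rw [h0] at h1
  simp only [Pi.zero_apply, mul_zero, Finset.sum_const_zero] at h1
  have hnn : 0 ≤ ∑ k, (w - w') k ^ 2 := Finset.sum_nonneg fun k _ => sq_nonneg _
  have h2 : ∑ k, (w - w') k ^ 2 = 0 := le_antisymm (by nlinarith) hnn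
  funext k
  have h3 := (Finset.sum_eq_zero_iff_of_nonneg (fun k _ => sq_nonneg ((w - w') k))).mp h2 k (Finset.mem_univ k)
  rwa [Pi.sub_apply, sq_eq_zero_iff, sub_eq_zero] at h3

/-- KERNEL-CHECKED: padding an operator M on F ⊆ Ω × Fin N that satisfies condition (5.6) of [3] on L²(F) (symmetric,
M ≥ γ, |M(f,f′)| ≤ c e^{−δ|f−f′|}) gives an operator on L²(Ω; R^N) satisfying (5.6) with (γ, c + γ, δ).
[cite: Balaban1983RegularityDecay, (5.6) p.594] -/
theorem hyp56_pad {d N : ℕ} {Ω : Finset (Fin d → ℤ)} {F : Finset (B4.Idx Ω N)} {M : Matrix F F ℝ}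
    {γ c δ : ℝ} (hγ : 0 ≤ γ) (hc : 0 ≤ c) (hs : M.IsSymm)
    (hl : ∀ w : F → ℝ, γ * ∑ f, w f ^ 2 ≤ ∑ f, w f * (M *ᵥ w) f)
    (hd : ∀ f f' : F, |M f f'| ≤ c * Real.exp (-(δ *
      dist ((f : B4.Idx Ω N).1 : Fin d → ℤ) ((f' : B4.Idx Ω N).1 : Fin d → ℤ)))) :
    B4.Hyp56 Ω (pad F M γ) γ (c + γ) δ :=
  ⟨pad_isSymm hs γ, pad_lower le_rfl hl, pad_decay (fun p : B4.Idx Ω N => (p.1 : Fin d → ℤ)) hc hγ hd⟩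

end Padding

/-! ## §2  The reduction scheme with an ARBITRARY sub-family of kept variables -/

section SubReduced

variable (d N : ℕ)

/-- ONE INSTANCE of a constrained unit-lattice Gaussian, as `B6FromB4.Reduction` but with the remaining variables B′
an ARBITRARY sub-family F of the variables Ω × Fin N (p. 249: *"If we denote the remaining variables by B′, then we
can write B = CB′"* — at (S5) the remaining bonds, all bonds minus pivots minus tree bonds, do not form a product set
Ω′ × Fin N′).  [cite: Balaban1984PropagatorsII, (2.154)–(2.156) pp.249–250] -/
structure SubReduction where
  /-- the lattice indices of the variables B -/
  Ω : Finset (Fin d → ℤ)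
  /-- the kept variables B′ ⊆ Ω × Fin N -/
  F : Finset (B4.Idx Ω N)
  /-- the operator of the quadratic form (Δ_k) -/
  Δ : Matrix (B4.Idx Ω N) (B4.Idx Ω N) ℝ
  /-- B = CB′ -/
  C : Matrix (B4.Idx Ω N) F ℝ

variable {d N}

/-- The covariance (2.156) verbatim: *"C^{(k)}_Λ = C(C*Δ_kC)⁻¹C*"* (the inverse is the matrix inverse on the kept
variables F; it is a genuine inverse under `Printed.lower`/`iso`, see `isUnit_det_of_lower`).
[cite: Balaban1984PropagatorsII, (2.156) p.250] -/
def SubReduction.cov (T : SubReduction d N) : Matrix (B4.Idx T.Ω N) (B4.Idx T.Ω N) ℝ :=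
  T.C * (T.Cᵀ * T.Δ * T.C)⁻¹ * T.Cᵀ

/-- The printed-shape inputs (as `B6FromB4.Reduction.Printed`): Δ symmetric with |Δ(b,b′)| ≤ c₀e^{−δ₀|b₋−b′₋|}; the
lower bound γ‖CB′‖² ≤ ⟨CB′, ΔCB′⟩ on the range of C ((2.153) ⇒ first inequality of (2.157)); ‖CB′‖ ≥ ‖B′‖ (second
inequality of (2.157)); *"C is a short-ranged operator"* with range ≤ r and ℓ¹ row/column sums ≤ m.
[cite: Balaban1984PropagatorsII, (2.153)–(2.157) pp.249–250] -/
structure SubReduction.Printed (T : SubReduction d N) (γ c₀ δ₀ r mC : ℝ) : Prop where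
  symm : T.Δ.IsSymm
  decay : ∀ p q : B4.Idx T.Ω N,
    |T.Δ p q| ≤ c₀ * Real.exp (-(δ₀ * dist (p.1 : Fin d → ℤ) (q.1 : Fin d → ℤ)))
  lower : ∀ w : T.F → ℝ,
    γ * ∑ u, (T.C *ᵥ w) u ^ 2 ≤ ∑ u, (T.C *ᵥ w) u * (T.Δ *ᵥ (T.C *ᵥ w)) u
  iso : ∀ w : T.F → ℝ, ∑ k, w k ^ 2 ≤ ∑ u, (T.C *ᵥ w) u ^ 2
  range : ∀ p k, T.C p k ≠ 0 → dist (p.1 : Fin d → ℤ) ((k : B4.Idx T.Ω N).1 : Fin d → ℤ) ≤ r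
  col : ∀ k, ∑ p, |T.C p k| ≤ mC
  row : ∀ p, ∑ k, |T.C p k| ≤ mC

/-- KERNEL-CHECKED, p. 250 *"C is a short-ranged operator, so C*Δ_kC has the same exponential decay as Δ_k. Now we
may apply the theory developed in Sect. 5 of [3] on unit lattice operators. It gives us an exponential decay, and all
the other properties, for the operator (C*Δ_kC)⁻¹, hence for C^{(k)}_Λ also"* — for an ARBITRARY sub-family of kept
variables: from the Sect. 5 Theorem of [3] (uniform reading, fibre N) there are ONE c and ONE δ such that every
instance with the printed-shape inputs (γ, c₀, δ₀, r, m) has |C(C*ΔC)⁻¹C*(b, b′)| ≤ c·e^{−δ|b₋−b′₋|}.  Chain: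
sandwich lemmas of `B6FromB4` ((5.6) for C*ΔC on L²(F) with (γ, c₀e^{2δ₀r}m², δ₀)) → `hyp56_pad` ((5.6) on
L²(Ω; R^N) with constant + γ) → `B6FromB4.engine_of_sect5Uniform` → `pad_inv` (the inverse of the padding restricted
to F is (C*ΔC)⁻¹) → `B6FromB4.sandwich_decay`; c = c₁e^{2δ₁r}m², δ = δ₁. [cite: Balaban1984PropagatorsII, p.250] -/
theorem subReductions_uniform (h5 : B4.Sect5ThmUniform d N) {γ c₀ δ₀ r mC : ℝ} (hγ : 0 < γ) (hc : 0 < c₀)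
    (hδ : 0 < δ₀) (hm : 0 < mC) :
    ∃ c δ : ℝ, 0 < c ∧ 0 < δ ∧ ∀ T : SubReduction d N, T.Printed γ c₀ δ₀ r mC →
      ∀ p q : B4.Idx T.Ω N,
        |T.cov p q| ≤ c * Real.exp (-(δ * dist (p.1 : Fin d → ℤ) (q.1 : Fin d → ℤ))) := by
  have hc'0 : 0 < c₀ * Real.exp (2 * δ₀ * r) * mC * mC := by positivity
  obtain ⟨c₁, δ₁, hc₁, hδ₁, H⟩ :=
    B6FromB4.engine_of_sect5Uniform h5 γ (c₀ * Real.exp (2 * δ₀ * r) * mC * mC + γ) δ₀ hγ (by positivity) hδ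
  refine ⟨c₁ * Real.exp (2 * δ₁ * r) * mC * mC, δ₁, by positivity, hδ₁, fun T hT p q => ?_⟩
  unfold SubReduction.cov
  have hMs : (T.Cᵀ * T.Δ * T.C).IsSymm := B6FromB4.sandwich_isSymm T.C hT.symm
  have hMl : ∀ w : T.F → ℝ, γ * ∑ k, w k ^ 2 ≤ ∑ k, w k * ((T.Cᵀ * T.Δ * T.C) *ᵥ w) k :=
    B6FromB4.sandwich_lowerBound T.C T.Δ hγ.le hT.lower hT.iso
  have hMd : ∀ k k' : T.F, |(T.Cᵀ * T.Δ * T.C) k k'| ≤ c₀ * Real.exp (2 * δ₀ * r) * mC * mC *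
      Real.exp (-(δ₀ * dist ((k : B4.Idx T.Ω N).1 : Fin d → ℤ) ((k' : B4.Idx T.Ω N).1 : Fin d → ℤ))) :=
    B6FromB4.sandwich_decay (fun u : B4.Idx T.Ω N => (u.1 : Fin d → ℤ))
      (fun k : T.F => ((k : B4.Idx T.Ω N).1 : Fin d → ℤ)) T.Cᵀ T.Δ T.C hc.le hδ.le
      (fun i u h => by
        rw [dist_comm]
        exact hT.range u i (by simpa using h))
      (fun i => by simpa using hT.col i) hT.range hT.col hT.decay
  have h56 := hyp56_pad hγ.le hc'0.le hMs hMl hMd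
  have hInv := H T.Ω _ h56
  have hdet : IsUnit (T.Cᵀ * T.Δ * T.C).det := isUnit_det_of_lower hγ hMl
  have hMinv : ∀ k k' : T.F, |(T.Cᵀ * T.Δ * T.C)⁻¹ k k'| ≤ c₁ *
      Real.exp (-(δ₁ * dist ((k : B4.Idx T.Ω N).1 : Fin d → ℤ) ((k' : B4.Idx T.Ω N).1 : Fin d → ℤ))) := by
    intro k k'
    have := hInv k k'
    rwa [pad_inv _ hdet hγ.ne', pad_coe] at this
  exact B6FromB4.sandwich_decay (fun k : T.F => ((k : B4.Idx T.Ω N).1 : Fin d → ℤ))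
    (fun u : B4.Idx T.Ω N => (u.1 : Fin d → ℤ)) T.C (T.Cᵀ * T.Δ * T.C)⁻¹ T.Cᵀ hc₁.le hδ₁.le
    hT.range hT.row
    (fun v k h => by
      rw [dist_comm]
      exact hT.range k v (by simpa using h))
    (fun k => by simpa using hT.row k) hMinv p q

end SubReduced

/-! ## §3  Bonds of the unit lattice, the averaging Q of B5 (1.11), the pivots b₀(c), the trees Γ_{y,x} -/

section Bonds

open B6Elimination

variable {d : ℕ} {L : ℕ}

/-- The unit vector e_μ of Z^d. [folklore] -/
def unitVec (μ : Fin d) : Fin d → ℤ := fun i => if i = μ then 1 else 0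

/-- Coordinates of e_μ. [folklore] -/
theorem unitVec_apply (μ i : Fin d) : unitVec μ i = if i = μ then 1 else 0 := rfl

/-- Coordinates of z + t e_μ. [folklore] -/
theorem add_smul_unitVec_apply (z : Fin d → ℤ) (t : ℤ) (μ i : Fin d) :
    (z + t • unitVec μ) i = z i + (if i = μ then t else 0) := by
  simp only [Pi.add_apply, Pi.smul_apply, unitVec_apply, smul_eq_mul, mul_ite, mul_one, mul_zero]

/-- Coordinates of z − t e_μ. [folklore] -/
theorem sub_smul_unitVec_apply (z : Fin d → ℤ) (t : ℤ) (μ i : Fin d) :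
    (z - t • unitVec μ) i = z i - (if i = μ then t else 0) := by
  simp only [Pi.sub_apply, Pi.smul_apply, unitVec_apply, smul_eq_mul, mul_ite, mul_one, mul_zero]

/-- A bond c = ⟨y, y + Le_μ⟩ of the L-lattice is recorded as the pair (c₋, μ) = (y, μ) (B5 p. 19: *"if c = ⟨y, y +
Le_μ⟩ then x(c) = x + Le_μ"*).  The PIVOT b₀(c) of B6 p. 249 (*"b₀ is a bond belonging to B(c) for some c ∈ Λ′, and
contained in c"*) is taken to be the last unit bond of c, ⟨y + (L−1)e_μ, y + Le_μ⟩; `pivSite L c` is its starting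
point y + (L−1)e_μ. [cite: Balaban1984PropagatorsII, p.249] -/
def pivSite (L : ℕ) (c : (Fin d → ℤ) × Fin d) : Fin d → ℤ := c.1 + ((L : ℤ) - 1) • unitVec c.2

/-- The bond of the L-lattice whose pivot would be the unit bond ⟨z, z + e_μ⟩: (z − (L−1)e_μ, μ). [folklore] -/
def cOf (L : ℕ) (z : Fin d → ℤ) (μ : Fin d) : (Fin d → ℤ) × Fin d := (z - ((L : ℤ) - 1) • unitVec μ, μ)

/-- Coordinates of the pivot site. [folklore] -/
theorem pivSite_apply (c : (Fin d → ℤ) × Fin d) (i : Fin d) :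
    pivSite L c i = c.1 i + (if i = c.2 then (L : ℤ) - 1 else 0) :=
  add_smul_unitVec_apply _ _ _ _

/-- Coordinates of `cOf`. [folklore] -/
theorem cOf_fst_apply (z : Fin d → ℤ) (μ i : Fin d) :
    (cOf L z μ).1 i = z i - (if i = μ then (L : ℤ) - 1 else 0) :=
  sub_smul_unitVec_apply _ _ _ _

/-- Direction of `cOf`. [folklore] -/
@[simp] theorem cOf_snd (z : Fin d → ℤ) (μ : Fin d) : (cOf L z μ).2 = μ := rfl

/-- `pivSite` inverts `cOf`. [folklore] -/
theorem pivSite_cOf (z : Fin d → ℤ) (μ : Fin d) : pivSite L (cOf L z μ) = z := by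
  funext i
  rw [pivSite_apply, cOf_snd, cOf_fst_apply]
  ring

/-- `cOf` inverts `pivSite`. [folklore] -/
theorem cOf_pivSite (c : (Fin d → ℤ) × Fin d) : cOf L (pivSite L c) c.2 = c := by
  refine Prod.ext (funext fun i => ?_) rfl
  rw [cOf_fst_apply, pivSite_apply]
  ring

/-- If ⟨z, z + e_μ⟩ is the pivot of c then z = pivSite c and μ is the direction of c. [folklore] -/
theorem eq_of_cOf_eq {z : Fin d → ℤ} {μ : Fin d} {c : (Fin d → ℤ) × Fin d} (h : cOf L z μ = c) :
    z = pivSite L c ∧ μ = c.2 := by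
  subst h
  exact ⟨(pivSite_cOf z μ).symm, rfl⟩

/-- The pairs (x, s), x ∈ B(c₋), 0 ≤ s < L, of the double sum (1.11) — (QB)_c = Σ_{x∈B(c₋)} L^{−(d+1)} B([x, x(c)]),
B([x, x + Le_μ]) = Σ_{s=0}^{L−1} B(⟨x + se_μ, x + (s+1)e_μ⟩) — whose unit bond starts at the point z.
[cite: Balaban1984PropagatorsI, (1.11) p.19] -/
def hits (L : ℕ) (c : (Fin d → ℤ) × Fin d) (z : Fin d → ℤ) : Finset ((Fin d → ℤ) × ℕ) :=
  (block L c.1 ×ˢ Finset.range L).filter fun xs => xs.1 + (xs.2 : ℤ) • unitVec c.2 = z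

/-- Membership in `hits`. [folklore] -/
theorem mem_hits {c : (Fin d → ℤ) × Fin d} {z : Fin d → ℤ} {xs : (Fin d → ℤ) × ℕ} :
    xs ∈ hits L c z ↔ (xs.1 ∈ block L c.1 ∧ xs.2 < L) ∧ xs.1 + (xs.2 : ℤ) • unitVec c.2 = z := by
  simp only [hits, Finset.mem_filter, Finset.mem_product, Finset.mem_range]

/-- The multiplicity with which the unit bond ⟨z, z + e_ν⟩ occurs in L^{d+1}(QB)(c) of (1.11): the number of pairs
(x, s) of the double sum with x + se_μ = z (and ν = μ, the direction of c). [cite: Balaban1984PropagatorsI, (1.11) p.19] -/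
def mult (L : ℕ) (c : (Fin d → ℤ) × Fin d) (z : Fin d → ℤ) (ν : Fin d) : ℕ :=
  if ν = c.2 then (hits L c z).card else 0

/-- The pairs hitting the pivot: (b₀(c)₋ − se_μ, s), s = 0, …, L − 1. [folklore] -/
theorem hits_pivSite (hL : 0 < L) (c : (Fin d → ℤ) × Fin d) :
    hits L c (pivSite L c) = (Finset.range L).image fun s : ℕ => (pivSite L c - (s : ℤ) • unitVec c.2, s) := by
  ext ⟨x, s⟩
  rw [mem_hits, Finset.mem_image]
  constructor
  · rintro ⟨⟨-, hs⟩, h⟩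
    exact ⟨s, Finset.mem_range.2 hs, by rw [← h, add_sub_cancel_right]⟩
  · rintro ⟨s', hs', h⟩
    rw [Prod.mk.injEq] at h
    obtain ⟨hx, rfl⟩ := h
    have hs2 := Finset.mem_range.1 hs'
    refine ⟨⟨?_, hs2⟩, by rw [← hx, sub_add_cancel]⟩
    rw [mem_block]
    intro i
    dsimp only
    rw [← hx, sub_smul_unitVec_apply, pivSite_apply]
    have hL1 : (1 : ℤ) ≤ L := by exact_mod_cast hL
    split_ifs <;> constructor <;> omega

/-- The pivot b₀(c) occurs in (QB)(c) with multiplicity L (weight L · L^{−(d+1)} = L^{−d} ≠ 0) — the coefficient by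
which the constraint δ((QB)(c)) is solved for B_{b₀(c)}. [folklore] -/
theorem mult_pivSite (hL : 0 < L) (c : (Fin d → ℤ) × Fin d) : mult L c (pivSite L c) c.2 = L := by
  rw [mult, if_pos rfl, hits_pivSite hL, Finset.card_image_of_injective, Finset.card_range]
  intro s s' h
  simpa using congrArg Prod.snd h

/-- Two multiples of L at distance < L are equal. [folklore] -/
theorem eq_of_dvd_of_lt_of_lt (hL : 0 < L) {a b : ℤ} (ha : (L : ℤ) ∣ a) (hb : (L : ℤ) ∣ b)
    (h1 : a - L < b) (h2 : b < a + L) : a = b := by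
  obtain ⟨k, hk⟩ := dvd_sub hb ha
  have hL' : (0 : ℤ) < L := by exact_mod_cast hL
  have hk1 : (L : ℤ) * k < L * 1 := by linarith
  have hk2 : (L : ℤ) * (-1) < L * k := by linarith
  have e1 := lt_of_mul_lt_mul_left hk1 hL'.le
  have e2 := lt_of_mul_lt_mul_left hk2 hL'.le
  have hk0 : k = 0 := by omega
  rw [hk0, mul_zero, sub_eq_zero] at hk
  exact hk.symm

/-- Distinct bonds of the L-lattice have distinct pivots, and more: the pivot of c′ occurs in (QB)(c) only if c′ = c
(both c₋, c′₋ ∈ LZ^d). [folklore] -/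
theorem eq_of_mult_pivSite_ne_zero (hL : 0 < L) {c c' : (Fin d → ℤ) × Fin d} (hc : ∀ i, (L : ℤ) ∣ c.1 i)
    (hc' : ∀ i, (L : ℤ) ∣ c'.1 i) (h : mult L c (pivSite L c') c'.2 ≠ 0) : c' = c := by
  unfold mult at h
  by_cases hμ : c'.2 = c.2
  swap
  · exact absurd (if_neg hμ) h
  rw [if_pos hμ] at h
  obtain ⟨⟨x, s⟩, hxs⟩ := Finset.card_ne_zero.mp h
  obtain ⟨⟨hx, hs⟩, hz⟩ := mem_hits.mp hxs
  rw [mem_block] at hx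
  have key : ∀ i, c'.1 i = c.1 i := by
    intro i
    have h1 := congrFun hz i
    rw [add_smul_unitVec_apply, pivSite_apply, hμ] at h1
    obtain ⟨hx1, hx2⟩ := hx i
    refine (eq_of_dvd_of_lt_of_lt hL (hc i) (hc' i) ?_ ?_).symm
    · split_ifs at h1 <;> omega
    · split_ifs at h1 <;> omega
  exact Prod.ext (funext key) hμ

/-- The same, for a unit bond given by its starting point: if ⟨z, z + e_ν⟩ occurs in (QB)(c) and z − (L−1)e_ν ∈
LZ^d, then c = (z − (L−1)e_ν, ν). [folklore] -/
theorem cOf_eq_of_mult_ne_zero (hL : 0 < L) {c : (Fin d → ℤ) × Fin d} {z : Fin d → ℤ} {ν : Fin d}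
    (hc : ∀ i, (L : ℤ) ∣ c.1 i) (hz : ∀ i, (L : ℤ) ∣ (cOf L z ν).1 i) (h : mult L c z ν ≠ 0) :
    cOf L z ν = c := by
  apply eq_of_mult_pivSite_ne_zero hL hc hz
  rwa [pivSite_cOf, cOf_snd]

/-- The block of the pivot of c is B(c₋). [folklore] -/
theorem corner_pivSite (hL : 0 < L) {c : (Fin d → ℤ) × Fin d} (hc : ∀ i, (L : ℤ) ∣ c.1 i) :
    corner L (pivSite L c) = c.1 := by
  have h0 : corner L c.1 = c.1 := corner_eq_self_of_dvd c.1 hc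
  rw [← h0]
  apply corner_eq_of_mem_block hL
  rw [h0, mem_block]
  intro i
  rw [pivSite_apply]
  have hL1 : (1 : ℤ) ≤ L := by exact_mod_cast hL
  split_ifs <;> constructor <;> omega

/-- RANGE: a unit bond occurring in (QB)(c) starts at sup-distance ≤ L − 1 from the pivot of c. [folklore] -/
theorem dist_le_of_mult_ne_zero (hL : 0 < L) {c : (Fin d → ℤ) × Fin d} {z : Fin d → ℤ} {ν : Fin d}
    (h : mult L c z ν ≠ 0) : dist (pivSite L c) z ≤ (L : ℝ) - 1 := by
  unfold mult at h
  by_cases hν : ν = c.2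
  swap
  · exact absurd (if_neg hν) h
  rw [if_pos hν] at h
  obtain ⟨⟨x, s⟩, hxs⟩ := Finset.card_ne_zero.mp h
  obtain ⟨⟨hx, hs⟩, hz⟩ := mem_hits.mp hxs
  rw [mem_block] at hx
  have hL1 : (1 : ℝ) ≤ L := by exact_mod_cast hL
  refine (dist_pi_le_iff (by linarith)).2 fun i => ?_
  rw [Int.dist_eq]
  have h1 := congrFun hz i
  rw [add_smul_unitVec_apply] at h1
  obtain ⟨hx1, hx2⟩ := hx i
  have h3 : -((L : ℤ) - 1) ≤ pivSite L c i - z i ∧ pivSite L c i - z i ≤ (L : ℤ) - 1 := by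
    rw [pivSite_apply]
    by_cases hi : i = c.2
    · rw [if_pos hi] at h1 ⊢
      constructor <;> omega
    · rw [if_neg hi] at h1 ⊢
      constructor <;> omega
  obtain ⟨h4, h5⟩ := h3
  have h6 := (Int.cast_le (R := ℝ)).2 h4
  have h7 := (Int.cast_le (R := ℝ)).2 h5
  push_cast at h6 h7
  rw [abs_le]
  exact ⟨by linarith, by linarith⟩

/-- The multiplicity of ⟨z, z + e_ν⟩ in (QB)(c) is at most the number of s ∈ [0, L) with z − se_ν ∈ B(c₋) (the
point x of the pair is determined by s). [folklore] -/
theorem mult_le_card (c : (Fin d → ℤ) × Fin d) (z : Fin d → ℤ) (ν : Fin d) :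
    mult L c z ν ≤ ((Finset.range L).filter fun s : ℕ =>
      z - (s : ℤ) • unitVec ν ∈ block L c.1 ∧ ν = c.2).card := by
  unfold mult
  by_cases hν : ν = c.2
  · rw [if_pos hν]
    apply Finset.card_le_card_of_injOn Prod.snd
    · intro xs hxs
      have hxs' := mem_hits.mp (Finset.mem_coe.mp hxs)
      rw [Finset.mem_coe, Finset.mem_filter, Finset.mem_range]
      refine ⟨hxs'.1.2, ?_, hν⟩
      rw [← hxs'.2, hν, add_sub_cancel_right]
      exact hxs'.1.1
    · intro xs hxs xs' hxs' h
      have e1 := (mem_hits.mp (Finset.mem_coe.mp hxs)).2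
      have e2 := (mem_hits.mp (Finset.mem_coe.mp hxs')).2
      refine Prod.ext ?_ h
      have e3 : xs.1 = z - (xs.2 : ℤ) • unitVec c.2 := by rw [← e1, add_sub_cancel_right]
      have e4 : xs'.1 = z - (xs'.2 : ℤ) • unitVec c.2 := by rw [← e2, add_sub_cancel_right]
      rw [e3, e4, show xs.2 = xs'.2 from h]
  · rw [if_neg hν]
    exact Nat.zero_le _

/-- COLUMN COUNT: a unit bond occurs, over ALL bonds c of the L-lattice (c₋ ∈ LZ^d) together, with total multiplicity
≤ L — the blocks B(c₋) of distinct c with the same direction are disjoint. [folklore] -/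
theorem sum_mult_le_L (hL : 0 < L) {K : Finset ((Fin d → ℤ) × Fin d)} (hK : ∀ c ∈ K, ∀ i, (L : ℤ) ∣ c.1 i)
    (z : Fin d → ℤ) (ν : Fin d) : ∑ c ∈ K, mult L c z ν ≤ L := by
  calc ∑ c ∈ K, mult L c z ν
      ≤ ∑ c ∈ K, ∑ s ∈ Finset.range L,
          (if z - (s : ℤ) • unitVec ν ∈ block L c.1 ∧ ν = c.2 then 1 else 0) := by
        refine Finset.sum_le_sum fun c _ => ?_
        rw [← Finset.card_filter]
        exact mult_le_card c z ν
    _ = ∑ s ∈ Finset.range L, ∑ c ∈ K,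
          (if z - (s : ℤ) • unitVec ν ∈ block L c.1 ∧ ν = c.2 then 1 else 0) := Finset.sum_comm
    _ ≤ ∑ s ∈ Finset.range L, 1 := by
        refine Finset.sum_le_sum fun s _ => ?_
        rw [← Finset.card_filter]
        refine Finset.card_le_one.2 fun c hc c' hc' => ?_
        rw [Finset.mem_filter] at hc hc'
        obtain ⟨hcK, hb, hν⟩ := hc
        obtain ⟨hcK', hb', hν'⟩ := hc'
        have e1 : corner L c.1 = c.1 := corner_eq_self_of_dvd c.1 (hK c hcK)
        have e1' : corner L c'.1 = c'.1 := corner_eq_self_of_dvd c'.1 (hK c' hcK')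
        rw [← e1, mem_block_corner_iff hL] at hb
        rw [← e1', mem_block_corner_iff hL] at hb'
        have e2 : c.1 = c'.1 := by
          rw [← e1, ← e1']
          exact hb.symm.trans hb'
        exact Prod.ext e2 (hν.symm.trans hν')
    _ = L := by simp

/-- At most one variable of L²(Ω; R^d) is the bond starting at w in direction μ. [folklore] -/
theorem sum_idx_ite_le_one {Ω : Finset (Fin d → ℤ)} (w : Fin d → ℤ) (μ : Fin d) :
    ∑ b : B4.Idx Ω d, (if w = (b.1 : Fin d → ℤ) ∧ b.2 = μ then 1 else 0 : ℕ) ≤ 1 := by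
  rw [← Finset.card_filter]
  refine Finset.card_le_one.2 fun b hb b' hb' => ?_
  simp only [Finset.mem_filter, Finset.mem_univ, true_and] at hb hb'
  exact Prod.ext (Subtype.ext (hb.1.symm.trans hb'.1)) (hb.2.trans hb'.2.symm)

/-- The multiplicity as an indicator sum over the pairs of (1.11). [folklore] -/
theorem mult_eq_sum_ite (c : (Fin d → ℤ) × Fin d) (z : Fin d → ℤ) (ν : Fin d) :
    mult L c z ν = ∑ xs ∈ block L c.1 ×ˢ Finset.range L,
      (if xs.1 + (xs.2 : ℤ) • unitVec c.2 = z ∧ ν = c.2 then 1 else 0) := by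
  unfold mult hits
  by_cases hν : ν = c.2
  · simp only [hν, and_true, if_true]
    exact Finset.card_filter _ _
  · simp [hν]

/-- ROW COUNT: the total multiplicity of (QB)(c) over the variables is ≤ |B(c₋)| · L = L^d · L. [folklore] -/
theorem sum_mult_le {Ω : Finset (Fin d → ℤ)} (c : (Fin d → ℤ) × Fin d) :
    ∑ b : B4.Idx Ω d, mult L c (b.1 : Fin d → ℤ) b.2 ≤ L ^ d * L := by
  calc ∑ b : B4.Idx Ω d, mult L c (b.1 : Fin d → ℤ) b.2
      = ∑ b : B4.Idx Ω d, ∑ xs ∈ block L c.1 ×ˢ Finset.range L,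
          (if xs.1 + (xs.2 : ℤ) • unitVec c.2 = (b.1 : Fin d → ℤ) ∧ b.2 = c.2 then 1 else 0) :=
        Finset.sum_congr rfl fun b _ => mult_eq_sum_ite c _ _
    _ = ∑ xs ∈ block L c.1 ×ˢ Finset.range L, ∑ b : B4.Idx Ω d,
          (if xs.1 + (xs.2 : ℤ) • unitVec c.2 = (b.1 : Fin d → ℤ) ∧ b.2 = c.2 then 1 else 0) :=
        Finset.sum_comm
    _ ≤ ∑ xs ∈ block L c.1 ×ˢ Finset.range L, 1 :=
        Finset.sum_le_sum fun xs _ => sum_idx_ite_le_one _ _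
    _ = L ^ d * L := by
        rw [Finset.sum_const, smul_eq_mul, mul_one, Finset.card_product, card_block, Finset.card_range]

variable {Ω : Finset (Fin d → ℤ)}

/-- B extended by zero to all unit bonds of Z^d (p. 250: *"CB′ = 0 outside Λ"*); the variable attached to the bond
⟨z, z + e_ν⟩ is B(⟨z, _⟩, ν) by B5 (1.1) *"A_{⟨x,x+εe_μ⟩} = A(x, x + εe_μ) = A_μ(x), x ∈ T_ε, μ = 1, …, d"*.
[cite: Balaban1984PropagatorsI, (1.1) p.18] -/
def extB (B : B4.Idx Ω d → ℝ) (z : Fin d → ℤ) (ν : Fin d) : ℝ :=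
  if h : z ∈ Ω then B (⟨z, h⟩, ν) else 0

/-- The zero extension as a sum over the variables. [folklore] -/
theorem extB_eq_sum (B : B4.Idx Ω d → ℝ) (z : Fin d → ℤ) (ν : Fin d) :
    extB B z ν = ∑ b : B4.Idx Ω d, if z = (b.1 : Fin d → ℤ) ∧ b.2 = ν then B b else 0 := by
  unfold extB
  by_cases hz : z ∈ Ω
  · rw [dif_pos hz, Finset.sum_eq_single (⟨z, hz⟩, ν)]
    · simp
    · intro b _ hb
      rw [if_neg]
      rintro ⟨h1, h2⟩
      exact hb (Prod.ext (Subtype.ext h1.symm) h2)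
    · intro h
      exact absurd (Finset.mem_univ _) h
  · rw [dif_neg hz]
    refine (Finset.sum_eq_zero fun b _ => ?_).symm
    rw [if_neg]
    rintro ⟨h1, -⟩
    rw [h1] at hz
    exact hz b.1.2

/-- B5 (1.11) VERBATIM: *"(QA)_c = Σ_{x∈B(c₋)} L^{−(d+1)} A([x, x(c)])"*, *"where A(Γ) = Σ_{b⊂Γ} A_b for arbitrary
contour Γ, and x(c) denotes a point in the block B(c₊) obtained by translation of x by the bond c, so if c = ⟨y, y +
Le_μ⟩ then x(c) = x + Le_μ"*: the straight contour [x, x + Le_μ] consists of the unit bonds ⟨x + se_μ, x + (s+1)e_μ⟩,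
s = 0, …, L − 1 (B extended by zero outside the region). [cite: Balaban1984PropagatorsI, (1.11) p.19] -/
def avgQ (L : ℕ) (B : B4.Idx Ω d → ℝ) (c : (Fin d → ℤ) × Fin d) : ℝ :=
  ∑ x ∈ block L c.1, ((L : ℝ) ^ (d + 1))⁻¹ *
    ∑ s ∈ Finset.range L, extB B (x + (s : ℤ) • unitVec c.2) c.2

/-- The double sum of (1.11) collected by unit bond. [folklore] -/
theorem sum_block_range_ite (c : (Fin d → ℤ) × Fin d) (b : B4.Idx Ω d) (g : ℝ) :
    ∑ x ∈ block L c.1, ∑ s ∈ Finset.range L,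
        (if x + (s : ℤ) • unitVec c.2 = (b.1 : Fin d → ℤ) ∧ b.2 = c.2 then g else 0)
      = (mult L c (b.1 : Fin d → ℤ) b.2 : ℝ) * g := by
  rw [← Finset.sum_product']
  unfold mult hits
  by_cases hν : b.2 = c.2
  · simp only [hν, and_true, if_true]
    rw [← Finset.sum_filter, Finset.sum_const, nsmul_eq_mul]
  · simp [hν]

/-- (QB)(c) = L^{−(d+1)} Σ_b mult_c(b) B(b): (1.11) as a weighted sum over the variables.
[cite: Balaban1984PropagatorsI, (1.11) p.19] -/
theorem avgQ_eq_sum_mult (B : B4.Idx Ω d → ℝ) (c : (Fin d → ℤ) × Fin d) :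
    avgQ L B c = ((L : ℝ) ^ (d + 1))⁻¹ * ∑ b : B4.Idx Ω d, (mult L c (b.1 : Fin d → ℤ) b.2 : ℝ) * B b := by
  unfold avgQ
  rw [← Finset.mul_sum]
  congr 1
  calc ∑ x ∈ block L c.1, ∑ s ∈ Finset.range L, extB B (x + (s : ℤ) • unitVec c.2) c.2
      = ∑ x ∈ block L c.1, ∑ s ∈ Finset.range L, ∑ b : B4.Idx Ω d,
          (if x + (s : ℤ) • unitVec c.2 = (b.1 : Fin d → ℤ) ∧ b.2 = c.2 then B b else 0) :=
        Finset.sum_congr rfl fun x _ => Finset.sum_congr rfl fun s _ => extB_eq_sum B _ _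
    _ = ∑ x ∈ block L c.1, ∑ b : B4.Idx Ω d, ∑ s ∈ Finset.range L,
          (if x + (s : ℤ) • unitVec c.2 = (b.1 : Fin d → ℤ) ∧ b.2 = c.2 then B b else 0) :=
        Finset.sum_congr rfl fun x _ => Finset.sum_comm
    _ = ∑ b : B4.Idx Ω d, ∑ x ∈ block L c.1, ∑ s ∈ Finset.range L,
          (if x + (s : ℤ) • unitVec c.2 = (b.1 : Fin d → ℤ) ∧ b.2 = c.2 then B b else 0) :=
        Finset.sum_comm
    _ = ∑ b : B4.Idx Ω d, (mult L c (b.1 : Fin d → ℤ) b.2 : ℝ) * B b :=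
        Finset.sum_congr rfl fun b _ => sum_block_range_ite c b (B b)

/-- B5 (1.7) VERBATIM: *"Γ_{y,x} = [y, (y₁, …, y_{d−1}, x_d)] ∪ … ∪ [(y₁, …, y_μ, x_{μ+1}, …, x_d), (y₁, …, x_μ,
x_{μ+1}, …, x_d)] ∪ … ∪ [(y₁, x₂, …, x_d), x]"* (x ∈ B(y)); (1.10): *"Axial (Ax) gauge fixing conditions A(Γ_{y,x}) =
0, x ∈ B(y), x ≠ y, y ∈ T_L^{(1)}"*; B6 p. 249: *"We remove the variables B_b for b ⊂ Γ_{y,x} using the δ-functions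
δ_{Ax}(B)"*.  A unit bond ⟨z, z + e_μ⟩ lies on some Γ_{y,x}, x ∈ B(y), iff z ∈ B(y), the coordinates of z before μ
are those of y, and z_μ + 1 < y_μ + L (the segment of direction μ runs from coordinate y_μ to x_μ ≤ y_μ + L − 1 with
the earlier coordinates still equal to y's); the tree of the block of y is the union of the Γ_{y,x}.  `IsTree L Y b`:
b is a bond of the tree of its block and that block's L-lattice point is in Y (Y = the points y ∈ Λ′ whose axial
gauge conditions are imposed) — PROVED equal to "b is a bond of Γ_y = ⋃_x Γ_{y,x} for some y ∈ Y" in `isTree_iff`, and the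
conditions (1.10) PROVED equivalent to "A_b = 0 on the bonds of Γ_y" in `axial_iff` (§3b).
[cite: Balaban1984PropagatorsI, (1.7)+(1.10) pp.18–19] -/
def IsTree (L : ℕ) (Y : Finset (Fin d → ℤ)) (p : B4.Idx Ω d) : Prop :=
  corner L (p.1 : Fin d → ℤ) ∈ Y ∧ (p.1 : Fin d → ℤ) p.2 + 1 < corner L (p.1 : Fin d → ℤ) p.2 + L ∧
    ∀ i, i < p.2 → (p.1 : Fin d → ℤ) i = corner L (p.1 : Fin d → ℤ) i

/-- `IsTree` is decidable (membership in a `Finset` and finitely many integer (in)equalities), so that the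
remaining-variable set `freeB` can be formed with `Finset.filter`. -/
instance (L : ℕ) (Y : Finset (Fin d → ℤ)) : DecidablePred (IsTree (Ω := Ω) L Y) := fun p => by
  unfold IsTree
  infer_instance

/-- A pivot b₀(c), c₋ ∈ LZ^d, is never a tree bond: it is the LAST unit bond of c inside B(c₋), while the tree
segments of direction μ stop at x_μ ≤ y_μ + L − 1. [folklore] -/
theorem not_isTree_of_piv (hL : 0 < L) {Y : Finset (Fin d → ℤ)} {c : (Fin d → ℤ) × Fin d}
    (hc : ∀ i, (L : ℤ) ∣ c.1 i) (p : B4.Idx Ω d) (hp : (p.1 : Fin d → ℤ) = pivSite L c) (hμ : p.2 = c.2) :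
    ¬ IsTree L Y p := by
  rintro ⟨-, h, -⟩
  rw [hp, hμ, corner_pivSite hL hc, pivSite_apply, if_pos rfl] at h
  omega

end Bonds

/-! ## §3b  Fidelity of the tree reading: the axial gauge conditions (1.10) = vanishing on the tree bonds -/

section Axial

open B6Elimination

variable {d : ℕ} {L : ℕ}

/-- The unit bonds of the contour Γ_{y,x} of B5 (1.7), x ∈ B(y): *"Γ_{y,x} = [y, (y₁, …, y_{d−1}, x_d)] ∪ … ∪
[(y₁, …, y_μ, x_{μ+1}, …, x_d), (y₁, …, x_μ, x_{μ+1}, …, x_d)] ∪ … ∪ [(y₁, x₂, …, x_d), x]"* — the segment of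
direction μ consists of the unit bonds ⟨w, w + e_μ⟩ with w_i = y_i (i < μ), w_i = x_i (i > μ), y_μ ≤ w_μ < x_μ;
B5 p. 19: *"A(Γ) = Σ_{b⊂Γ} A_b for arbitrary contour Γ"*. [cite: Balaban1984PropagatorsI, (1.7) p.18] -/
def contour (L : ℕ) (y x : Fin d → ℤ) : Finset ((Fin d → ℤ) × Fin d) :=
  (block L y ×ˢ (Finset.univ : Finset (Fin d))).filter fun b =>
    (∀ i, i < b.2 → b.1 i = y i) ∧ (∀ i, b.2 < i → b.1 i = x i) ∧ b.1 b.2 < x b.2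

/-- Membership in Γ_{y,x}. [folklore] -/
theorem mem_contour {y x : Fin d → ℤ} {b : (Fin d → ℤ) × Fin d} :
    b ∈ contour L y x ↔
      b.1 ∈ block L y ∧ (∀ i, i < b.2 → b.1 i = y i) ∧ (∀ i, b.2 < i → b.1 i = x i) ∧ b.1 b.2 < x b.2 := by
  simp only [contour, Finset.mem_filter, Finset.mem_product, Finset.mem_univ, and_true]

/-- The unit bonds of the TREE Γ_y = ⋃_{x ∈ B(y)} Γ_{y,x} (B6 p. 249: *"the variables B_b for b ⊂ Γ_{y,x}"*):
⟨w, w + e_μ⟩ with w ∈ B(y), w_i = y_i (i < μ) and w_μ + 1 < y_μ + L. [cite: Balaban1984PropagatorsI, (1.7) p.18] -/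
def treeBonds (L : ℕ) (y : Fin d → ℤ) : Finset ((Fin d → ℤ) × Fin d) :=
  (block L y ×ˢ (Finset.univ : Finset (Fin d))).filter fun b =>
    (∀ i, i < b.2 → b.1 i = y i) ∧ b.1 b.2 + 1 < y b.2 + L

/-- Membership in Γ_y. [folklore] -/
theorem mem_treeBonds {y : Fin d → ℤ} {b : (Fin d → ℤ) × Fin d} :
    b ∈ treeBonds L y ↔ b.1 ∈ block L y ∧ (∀ i, i < b.2 → b.1 i = y i) ∧ b.1 b.2 + 1 < y b.2 + L := by
  simp only [treeBonds, Finset.mem_filter, Finset.mem_product, Finset.mem_univ, and_true]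

/-- Every contour Γ_{y,x}, x ∈ B(y), consists of tree bonds. [folklore] -/
theorem contour_subset_treeBonds {y x : Fin d → ℤ} (hx : x ∈ block L y) : contour L y x ⊆ treeBonds L y := by
  intro b hb
  obtain ⟨hw, h1, -, h3⟩ := mem_contour.1 hb
  have h4 := (mem_block.1 hx b.2).2
  exact mem_treeBonds.2 ⟨hw, h1, by omega⟩

/-- Γ_{y,y} has no bonds. [folklore] -/
theorem contour_self (y : Fin d → ℤ) : contour L y y = ∅ :=
  Finset.subset_empty.1 fun b hb => by
    obtain ⟨hw, -, -, h3⟩ := mem_contour.1 hb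
    have h4 := (mem_block.1 hw b.2).1
    omega

/-- The bond ⟨z, z + e_μ⟩ is not on Γ_{y,z}. [folklore] -/
theorem not_mem_contour (y z : Fin d → ℤ) (μ : Fin d) : (z, μ) ∉ contour L y z := by
  intro h
  obtain ⟨-, -, -, h3⟩ := mem_contour.1 h
  exact lt_irrefl _ h3

/-- Coordinates of z + e_μ. [folklore] -/
theorem add_unitVec_apply (z : Fin d → ℤ) (μ i : Fin d) : (z + unitVec μ) i = z i + if i = μ then 1 else 0 := by
  rw [Pi.add_apply, unitVec_apply]

/-- For a tree bond ⟨z, z + e_μ⟩ the end-point z + e_μ stays in the block. [folklore] -/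
theorem add_unitVec_mem_block {y z : Fin d → ℤ} {μ : Fin d} (hz : z ∈ block L y) (h2 : z μ + 1 < y μ + L) :
    z + unitVec μ ∈ block L y := by
  rw [mem_block] at hz ⊢
  intro i
  have h := hz i
  rw [add_unitVec_apply]
  by_cases hi : i = μ
  · subst hi
    rw [if_pos rfl]
    omega
  · rw [if_neg hi]
    omega

/-- KEY STEP (the telescoping of (1.10) along the tree): for a tree bond ⟨z, z + e_μ⟩ (z ∈ B(y), z_i = y_i for i < μ),
Γ_{y,z+e_μ} = Γ_{y,z} ∪ {⟨z, z + e_μ⟩}. [folklore] -/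
theorem contour_add_unitVec {y z : Fin d → ℤ} {μ : Fin d} (hz : z ∈ block L y) (h1 : ∀ i, i < μ → z i = y i) :
    contour L y (z + unitVec μ) = insert (z, μ) (contour L y z) := by
  ext ⟨w, ν⟩
  rw [Finset.mem_insert, mem_contour, mem_contour, Prod.mk.injEq]
  simp only [add_unitVec_apply]
  constructor
  · rintro ⟨hw, hwy, hwx, hlt⟩
    rcases lt_trichotomy ν μ with hνμ | rfl | hμν
    · exfalso
      rw [if_neg hνμ.ne] at hlt
      have h3 := (mem_block.1 hw ν).1
      have h4 := h1 ν hνμ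
      omega
    · rw [if_pos rfl] at hlt
      by_cases hwz : w ν = z ν
      · left
        refine ⟨funext fun i => ?_, rfl⟩
        rcases lt_trichotomy i ν with hi | rfl | hi
        · rw [hwy i hi, h1 i hi]
        · exact hwz
        · have h3 := hwx i hi
          rw [if_neg hi.ne'] at h3
          omega
      · right
        refine ⟨hw, hwy, fun i hi => ?_, by omega⟩
        have h3 := hwx i hi
        rw [if_neg hi.ne'] at h3
        omega
    · right
      rw [if_neg hμν.ne'] at hlt
      refine ⟨hw, hwy, fun i hi => ?_, by omega⟩
      have h3 := hwx i hi
      rw [if_neg (hμν.trans hi).ne'] at h3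
      omega
  · rintro (⟨rfl, rfl⟩ | ⟨hw, hwy, hwx, hlt⟩)
    · refine ⟨hz, h1, fun i hi => ?_, ?_⟩
      · rw [if_neg hi.ne']
        omega
      · rw [if_pos rfl]
        omega
    · refine ⟨hw, hwy, fun i hi => ?_, ?_⟩
      · rw [hwx i hi]
        by_cases hiμ : i = μ
        · exfalso
          subst hiμ
          have h3 := h1 ν hi
          have h4 := (mem_block.1 hw ν).1
          omega
        · rw [if_neg hiμ, add_zero]
      · by_cases hνμ : ν = μ
        · subst hνμ
          rw [if_pos rfl]
          omega
        · rw [if_neg hνμ]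
          omega

/-- FIDELITY OF THE TREE CONSTRAINT (KERNEL-CHECKED): the axial gauge conditions (1.10) of B5, *"A(Γ_{y,x}) = 0,
x ∈ B(y), x ≠ y"*, hold iff A_b = 0 for every bond b of the tree Γ_y = ⋃_{x∈B(y)} Γ_{y,x} — which is what B6 p. 249
uses in *"We remove the variables B_b for b ⊂ Γ_{y,x} using the δ-functions δ_{Ax}(B)"* (⇒: Γ_{y,z+e_μ} = Γ_{y,z} ∪
{⟨z, z + e_μ⟩} for a tree bond, so A_{⟨z,z+e_μ⟩} = A(Γ_{y,z+e_μ}) − A(Γ_{y,z}) = 0; ⇐: trivially).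
[cite: Balaban1984PropagatorsI, (1.10) p.19] -/
theorem axial_iff (y : Fin d → ℤ) (A : (Fin d → ℤ) × Fin d → ℝ) :
    (∀ x ∈ block L y, x ≠ y → ∑ b ∈ contour L y x, A b = 0) ↔ ∀ b ∈ treeBonds L y, A b = 0 := by
  constructor
  · intro h b hb
    obtain ⟨hz, h1, h2⟩ := mem_treeBonds.1 hb
    have hx : b.1 + unitVec b.2 ∈ block L y := add_unitVec_mem_block hz h2
    have hne : b.1 + unitVec b.2 ≠ y := by
      intro e
      have h3 := congr_fun e b.2
      rw [add_unitVec_apply, if_pos rfl] at h3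
      have h4 := (mem_block.1 hz b.2).1
      omega
    have hsum := h _ hx hne
    rw [contour_add_unitVec hz h1, Finset.sum_insert (not_mem_contour y b.1 b.2)] at hsum
    have h0 : ∑ b' ∈ contour L y b.1, A b' = 0 := by
      by_cases hzy : b.1 = y
      · rw [hzy, contour_self, Finset.sum_empty]
      · exact h _ hz hzy
    rw [h0, add_zero] at hsum
    exact hsum
  · intro h x hx _
    exact Finset.sum_eq_zero fun b hb => h b (contour_subset_treeBonds hx hb)

/-- The typed predicate `IsTree L Y` IS "a bond of the tree Γ_y of some y ∈ Y" (Y ⊂ LZ^d). [folklore] -/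
theorem isTree_iff (hL : 0 < L) {Ω : Finset (Fin d → ℤ)} {Y : Finset (Fin d → ℤ)}
    (hY : ∀ y ∈ Y, ∀ i, (L : ℤ) ∣ y i) (p : B4.Idx Ω d) :
    IsTree L Y p ↔ ∃ y ∈ Y, ((p.1 : Fin d → ℤ), p.2) ∈ treeBonds L y := by
  constructor
  · rintro ⟨hYc, h2, h1⟩
    exact ⟨_, hYc, mem_treeBonds.2 ⟨mem_block_corner hL _, h1, h2⟩⟩
  · rintro ⟨y, hy, hb⟩
    obtain ⟨hz, h1, h2⟩ := mem_treeBonds.1 hb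
    have hc : corner L (p.1 : Fin d → ℤ) = y := by
      rw [← corner_eq_self_of_dvd y (hY y hy)] at hz
      rw [corner_eq_of_mem_block hL hz, corner_eq_self_of_dvd y (hY y hy)]
    refine ⟨hc ▸ hy, ?_, fun i hi => ?_⟩
    · rw [hc]
      exact h2
    · rw [hc]
      exact h1 i hi

/-- The 0-extension at a variable. [folklore] -/
theorem extB_of_mem {Ω : Finset (Fin d → ℤ)} (B : B4.Idx Ω d → ℝ) {z : Fin d → ℤ} (hz : z ∈ Ω) (ν : Fin d) :
    extB B z ν = B (⟨z, hz⟩, ν) := by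
  rw [extB, dif_pos hz]

/-- The 0-extension restricted back. [folklore] -/
theorem extB_coe {Ω : Finset (Fin d → ℤ)} (B : B4.Idx Ω d → ℝ) (p : B4.Idx Ω d) :
    extB B (p.1 : Fin d → ℤ) p.2 = B p := by
  simp only [extB, dif_pos p.1.2, Subtype.coe_eta, Prod.mk.eta]

/-- Hence, for Y ⊂ LZ^d whose blocks lie in Ω (as the blocks of Λ′ lie in Λ) and a function B of the bonds starting
in Ω (extended by 0), "B = 0 on the bonds with `IsTree L Y`" is exactly the family of axial gauge conditions (1.10)
*"B(Γ_{y,x}) = 0 for x ∈ B(y)"* [x ≠ y], y ∈ Y, of (2.153)/(2.154). [cite: Balaban1984PropagatorsI, (1.10) p.19] -/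
theorem tree_iff_axial (hL : 0 < L) {Ω : Finset (Fin d → ℤ)} {Y : Finset (Fin d → ℤ)}
    (hY : ∀ y ∈ Y, ∀ i, (L : ℤ) ∣ y i) (hYΩ : ∀ y ∈ Y, block L y ⊆ Ω) (B : B4.Idx Ω d → ℝ) :
    (∀ p, IsTree L Y p → B p = 0) ↔
      ∀ y ∈ Y, ∀ x ∈ block L y, x ≠ y → ∑ b ∈ contour L y x, extB B b.1 b.2 = 0 := by
  constructor
  · intro h y hy
    refine (axial_iff y fun b => extB B b.1 b.2).2 fun b hb => ?_
    have hbΩ : b.1 ∈ Ω := hYΩ y hy (mem_treeBonds.1 hb).1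
    show extB B b.1 b.2 = 0
    rw [extB_of_mem B hbΩ]
    refine h _ ((isTree_iff hL hY _).2 ⟨y, hy, ?_⟩)
    simpa only [Prod.mk.eta] using hb
  · intro h p hp
    obtain ⟨y, hy, hb⟩ := (isTree_iff hL hY p).1 hp
    have h1 := (axial_iff y fun b => extB B b.1 b.2).1 (h y hy) _ hb
    rw [← extB_coe B p]
    exact h1

end Axial

/-! ## §4  The elimination B = CB′ of p. 250 and its locality constants -/

section Elimination

open B6Elimination

variable {d : ℕ} (L : ℕ) (Ω : Finset (Fin d → ℤ)) (K : Finset ((Fin d → ℤ) × Fin d)) (Y : Finset (Fin d → ℤ))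

/-- The REMAINING VARIABLES B′ of p. 249, *"We remove the variables B_b for b ⊂ Γ_{y,x} … Next we remove the
variables B_{b₀} … If we denote the remaining variables by B′"*: the bonds (starting in Ω) other than the pivots
b₀(c), c ∈ K (print: c ∈ Λ′), and the tree bonds of the points of Y (print: y ∈ Λ′).
[cite: Balaban1984PropagatorsII, p.249] -/
def freeB : Finset (B4.Idx Ω d) :=
  Finset.univ.filter fun p => cOf L (p.1 : Fin d → ℤ) p.2 ∉ K ∧ ¬ IsTree L Y p

variable {L Ω K Y}

/-- Membership in the remaining variables. [folklore] -/
theorem mem_freeB {p : B4.Idx Ω d} :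
    p ∈ freeB L Ω K Y ↔ cOf L (p.1 : Fin d → ℤ) p.2 ∉ K ∧ ¬ IsTree L Y p := by
  simp [freeB]

variable (L Ω K Y)

/-- THE ELIMINATION MATRIX C of p. 250, B = CB′: a remaining variable is copied; a tree bond is set to 0 (δ_{Ax});
the pivot b₀(c) is solved from δ((QB)(c)): B_{b₀(c)} = −L^{−1} Σ_{b′ remaining} mult_c(b′) B′_{b′} (the pivot has
multiplicity L in L^{d+1}(QB)(c), tree bonds contribute 0, other pivots do not occur in (QB)(c)).
[cite: Balaban1984PropagatorsII, (2.154)–(2.156) pp.249–250] -/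
def elimB : Matrix (B4.Idx Ω d) (freeB L Ω K Y) ℝ :=
  Matrix.of fun p f =>
    if p = (f : B4.Idx Ω d) then 1
    else if IsTree L Y p ∨ cOf L (p.1 : Fin d → ℤ) p.2 ∉ K then 0
    else -((mult L (cOf L (p.1 : Fin d → ℤ) p.2) ((f : B4.Idx Ω d).1 : Fin d → ℤ) (f : B4.Idx Ω d).2 : ℝ) / L)

/-- ADMISSIBLE constraint data: every constraint bond c ∈ K is a bond of the L-lattice (c₋ ∈ LZ^d) whose pivot is a
variable (its starting point lies in Ω).  In the print: c ∈ Λ′ ⊂ T^{(k+1)} and Λ ⊇ the bonds of the blocks B(c).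
[cite: Balaban1984PropagatorsII, p.249] -/
def Admissible : Prop :=
  ∀ c ∈ K, (∀ i, (L : ℤ) ∣ c.1 i) ∧ pivSite L c ∈ Ω

variable {L Ω K Y}

/-- The entries of C, unfolded. [folklore] -/
theorem elimB_apply (p : B4.Idx Ω d) (f : freeB L Ω K Y) :
    elimB L Ω K Y p f =
      if p = (f : B4.Idx Ω d) then 1
      else if IsTree L Y p ∨ cOf L (p.1 : Fin d → ℤ) p.2 ∉ K then 0
      else -((mult L (cOf L (p.1 : Fin d → ℤ) p.2) ((f : B4.Idx Ω d).1 : Fin d → ℤ) (f : B4.Idx Ω d).2 : ℝ) / L) :=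
  rfl

/-- Diagonal entries of C on the remaining variables are 1. [folklore] -/
theorem elimB_apply_self (f : freeB L Ω K Y) : elimB L Ω K Y (f : B4.Idx Ω d) f = 1 := by
  rw [elimB_apply, if_pos rfl]

/-- Off-diagonal entries of C vanish in the rows of tree bonds and of remaining variables. [folklore] -/
theorem elimB_apply_zero {p : B4.Idx Ω d} {f : freeB L Ω K Y} (h1 : p ≠ (f : B4.Idx Ω d))
    (h2 : IsTree L Y p ∨ cOf L (p.1 : Fin d → ℤ) p.2 ∉ K) : elimB L Ω K Y p f = 0 := by
  rw [elimB_apply, if_neg h1, if_pos h2]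

/-- The pivot rows of C: −mult/L. [folklore] -/
theorem elimB_apply_piv {p : B4.Idx Ω d} {f : freeB L Ω K Y} (h1 : p ≠ (f : B4.Idx Ω d))
    (ht : ¬ IsTree L Y p) (hK : cOf L (p.1 : Fin d → ℤ) p.2 ∈ K) :
    elimB L Ω K Y p f =
      -((mult L (cOf L (p.1 : Fin d → ℤ) p.2) ((f : B4.Idx Ω d).1 : Fin d → ℤ) (f : B4.Idx Ω d).2 : ℝ) / L) := by
  rw [elimB_apply, if_neg h1, if_neg (fun h => h.elim ht (fun h' => h' hK))]

/-- The entries of CB′. [folklore] -/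
theorem elimB_mulVec_apply (w : freeB L Ω K Y → ℝ) (p : B4.Idx Ω d) :
    (elimB L Ω K Y *ᵥ w) p =
      if hp : p ∈ freeB L Ω K Y then w ⟨p, hp⟩
      else if IsTree L Y p then 0
      else -(∑ f : freeB L Ω K Y, (mult L (cOf L (p.1 : Fin d → ℤ) p.2) ((f : B4.Idx Ω d).1 : Fin d → ℤ)
              (f : B4.Idx Ω d).2 : ℝ) * w f) / L := by
  simp only [Matrix.mulVec, dotProduct, elimB, Matrix.of_apply]
  by_cases hp : p ∈ freeB L Ω K Y
  · rw [dif_pos hp, Finset.sum_eq_single ⟨p, hp⟩]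
    · simp
    · intro f _ hf
      have hne : p ≠ (f : B4.Idx Ω d) := fun h => hf (Subtype.ext h).symm
      rw [if_neg hne, if_pos (Or.inr (mem_freeB.1 hp).1), zero_mul]
    · intro h
      exact absurd (Finset.mem_univ _) h
  · rw [dif_neg hp]
    by_cases ht : IsTree L Y p
    · rw [if_pos ht]
      refine Finset.sum_eq_zero fun f _ => ?_
      have hne : p ≠ (f : B4.Idx Ω d) := fun h => (mem_freeB.1 (h ▸ f.2)).2 ht
      rw [if_neg hne, if_pos (Or.inl ht), zero_mul]
    · rw [if_neg ht]
      have hK : cOf L (p.1 : Fin d → ℤ) p.2 ∈ K := by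
        by_contra h
        exact hp (mem_freeB.2 ⟨h, ht⟩)
      have h1 : ∀ f : freeB L Ω K Y, (if p = (f : B4.Idx Ω d) then (1 : ℝ)
          else if IsTree L Y p ∨ cOf L (p.1 : Fin d → ℤ) p.2 ∉ K then 0
          else -((mult L (cOf L (p.1 : Fin d → ℤ) p.2) ((f : B4.Idx Ω d).1 : Fin d → ℤ)
            (f : B4.Idx Ω d).2 : ℝ) / L)) * w f =
          -((mult L (cOf L (p.1 : Fin d → ℤ) p.2) ((f : B4.Idx Ω d).1 : Fin d → ℤ)
            (f : B4.Idx Ω d).2 : ℝ) * w f) / L := by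
        intro f
        have hne : p ≠ (f : B4.Idx Ω d) := fun h => (mem_freeB.1 (h ▸ f.2)).1 hK
        have hno : ¬ (IsTree L Y p ∨ cOf L (p.1 : Fin d → ℤ) p.2 ∉ K) :=
          fun h => h.elim ht (fun h' => h' hK)
        rw [if_neg hne, if_neg hno]
        ring
      rw [Finset.sum_congr rfl fun f _ => h1 f, ← Finset.sum_div, Finset.sum_neg_distrib]

/-- (CB′)(b′) = B′(b′) on the remaining variables: B′ ↦ CB′ ↦ restriction is the identity (p. 249 *"we can write
B = CB′"*). [cite: Balaban1984PropagatorsII, p.249] -/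
theorem elimB_mulVec_free (w : freeB L Ω K Y → ℝ) (f : freeB L Ω K Y) :
    (elimB L Ω K Y *ᵥ w) f = w f := by
  rw [elimB_mulVec_apply, dif_pos f.2]

/-- KERNEL-CHECKED, p. 250 *"(CB′)(Γ_{y,x}) = 0, x ∈ B(y), y ∈ Λ′, for arbitrary B′"*: CB′ vanishes on every tree
bond. [cite: Balaban1984PropagatorsII, p.250] -/
theorem elimB_mulVec_tree (w : freeB L Ω K Y → ℝ) {p : B4.Idx Ω d} (hp : IsTree L Y p) :
    (elimB L Ω K Y *ᵥ w) p = 0 := by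
  have hF : p ∉ freeB L Ω K Y := fun h => (mem_freeB.1 h).2 hp
  rw [elimB_mulVec_apply, dif_neg hF, if_pos hp]

/-- The columns of C are annihilated by the functional b ↦ mult_c(b) of every constraint c ∈ K. [folklore] -/
theorem sum_mult_elimB (hL : 0 < L) (hK : Admissible L Ω K) {c : (Fin d → ℤ) × Fin d} (hc : c ∈ K)
    (f : freeB L Ω K Y) :
    ∑ p : B4.Idx Ω d, (mult L c (p.1 : Fin d → ℤ) p.2 : ℝ) * elimB L Ω K Y p f = 0 := by
  obtain ⟨hcL, hcΩ⟩ := hK c hc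
  have hfK : cOf L ((f : B4.Idx Ω d).1 : Fin d → ℤ) (f : B4.Idx Ω d).2 ∉ K := (mem_freeB.1 f.2).1
  have hb₀K : cOf L (pivSite L c) c.2 ∈ K := by
    rw [cOf_pivSite]
    exact hc
  have hne : (f : B4.Idx Ω d) ≠ ((⟨pivSite L c, hcΩ⟩, c.2) : B4.Idx Ω d) := by
    intro h
    rw [h] at hfK
    exact hfK hb₀K
  have hb₀t : ¬ IsTree L Y ((⟨pivSite L c, hcΩ⟩, c.2) : B4.Idx Ω d) := not_isTree_of_piv hL hcL _ rfl rfl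
  have hLr : (L : ℝ) ≠ 0 := by exact_mod_cast hL.ne'
  have e2 : elimB L Ω K Y ((⟨pivSite L c, hcΩ⟩, c.2) : B4.Idx Ω d) f =
      -((mult L c ((f : B4.Idx Ω d).1 : Fin d → ℤ) (f : B4.Idx Ω d).2 : ℝ) / L) := by
    rw [elimB_apply_piv hne.symm hb₀t hb₀K]
    dsimp only
    rw [cOf_pivSite]
  have e3 : (mult L c (((⟨pivSite L c, hcΩ⟩, c.2) : B4.Idx Ω d).1 : Fin d → ℤ)
      ((⟨pivSite L c, hcΩ⟩, c.2) : B4.Idx Ω d).2 : ℝ) = L := by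
    dsimp only
    rw [mult_pivSite hL]
  rw [Fintype.sum_eq_add (f : B4.Idx Ω d) ((⟨pivSite L c, hcΩ⟩, c.2) : B4.Idx Ω d) hne, elimB_apply_self, e2, e3]
  · field_simp
    ring
  · intro p hp
    obtain ⟨hpf, hpb⟩ := hp
    by_cases h2 : IsTree L Y p ∨ cOf L (p.1 : Fin d → ℤ) p.2 ∉ K
    · rw [elimB_apply_zero hpf h2, mul_zero]
    · have hpK : cOf L (p.1 : Fin d → ℤ) p.2 ∈ K := by
        by_contra h
        exact h2 (Or.inr h)
      have hm : mult L c (p.1 : Fin d → ℤ) p.2 = 0 := by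
        by_contra hm
        have e := cOf_eq_of_mult_ne_zero hL hcL (hK _ hpK).1 hm
        obtain ⟨e1, e4⟩ := eq_of_cOf_eq e
        exact hpb (Prod.ext (Subtype.ext e1) e4)
      rw [hm, Nat.cast_zero, zero_mul]

/-- KERNEL-CHECKED, p. 250 *"By the definition of C we have of course that … QCB′ = 0 … for arbitrary B′"*: (QCB′)(c) =
0 for every constraint c ∈ K. [cite: Balaban1984PropagatorsII, p.250] -/
theorem avgQ_elimB_mulVec (hL : 0 < L) (hK : Admissible L Ω K) (w : freeB L Ω K Y → ℝ)
    {c : (Fin d → ℤ) × Fin d} (hc : c ∈ K) : avgQ L (elimB L Ω K Y *ᵥ w) c = 0 := by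
  rw [avgQ_eq_sum_mult]
  have h0 : ∑ b : B4.Idx Ω d, (mult L c (b.1 : Fin d → ℤ) b.2 : ℝ) * (elimB L Ω K Y *ᵥ w) b = 0 := by
    simp only [Matrix.mulVec, dotProduct, Finset.mul_sum]
    rw [Finset.sum_comm]
    refine Finset.sum_eq_zero fun f _ => ?_
    have h1 := sum_mult_elimB (Y := Y) hL hK hc f
    calc ∑ b : B4.Idx Ω d, (mult L c (b.1 : Fin d → ℤ) b.2 : ℝ) * (elimB L Ω K Y b f * w f)
        = (∑ b : B4.Idx Ω d, (mult L c (b.1 : Fin d → ℤ) b.2 : ℝ) * elimB L Ω K Y b f) * w f := by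
          rw [Finset.sum_mul]
          exact Finset.sum_congr rfl fun b _ => by ring
      _ = 0 := by rw [h1, zero_mul]
  rw [h0, mul_zero]

/-- The restriction B ↦ B′ = B↾(remaining variables). [folklore] -/
def restrB (L : ℕ) (K : Finset ((Fin d → ℤ) × Fin d)) (Y : Finset (Fin d → ℤ)) (B : B4.Idx Ω d → ℝ) :
    freeB L Ω K Y → ℝ :=
  fun f => B f

/-- KERNEL-CHECKED (the constrained subspace is parametrized by C): for B with (QB)(c) = 0, c ∈ K, and B = 0 on the
tree bonds, C(B↾remaining) = B — C is onto {QB = 0, B(Γ_{y,x}) = 0}, with the coordinate projection as inverse (what the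
change of variables (2.154) = (2.155) uses). [cite: Balaban1984PropagatorsII, (2.154)–(2.155) pp.249–250] -/
theorem elimB_restrB (hL : 0 < L) (hK : Admissible L Ω K) {B : B4.Idx Ω d → ℝ}
    (h1 : ∀ c ∈ K, avgQ L B c = 0) (h2 : ∀ p, IsTree L Y p → B p = 0) :
    elimB L Ω K Y *ᵥ restrB L K Y B = B := by
  funext p
  rw [elimB_mulVec_apply]
  by_cases hp : p ∈ freeB L Ω K Y
  · rw [dif_pos hp]
    rfl
  rw [dif_neg hp]
  by_cases ht : IsTree L Y p
  · rw [if_pos ht, h2 p ht]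
  rw [if_neg ht]
  have hcK : cOf L (p.1 : Fin d → ℤ) p.2 ∈ K := by
    by_contra h
    exact hp (mem_freeB.2 ⟨h, ht⟩)
  obtain ⟨hcL, -⟩ := hK _ hcK
  have h0 : ∑ b : B4.Idx Ω d, (mult L (cOf L (p.1 : Fin d → ℤ) p.2) (b.1 : Fin d → ℤ) b.2 : ℝ) * B b = 0 := by
    have h := h1 _ hcK
    rw [avgQ_eq_sum_mult] at h
    have hLne : ((L : ℝ) ^ (d + 1))⁻¹ ≠ 0 := by positivity
    exact (mul_eq_zero.mp h).resolve_left hLne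
  rw [← Finset.sum_add_sum_compl (freeB L Ω K Y), ← Finset.sum_coe_sort (freeB L Ω K Y),
    Finset.sum_eq_single_of_mem p (Finset.mem_compl.2 hp)] at h0
  · have hm : mult L (cOf L (p.1 : Fin d → ℤ) p.2) (p.1 : Fin d → ℤ) p.2 = L := by
      have h := mult_pivSite hL (cOf L (p.1 : Fin d → ℤ) p.2)
      rwa [pivSite_cOf, cOf_snd] at h
    rw [hm] at h0
    have hLr : (L : ℝ) ≠ 0 := by exact_mod_cast hL.ne'
    simp only [restrB]
    field_simp
    linarith
  · intro b hb hbp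
    by_cases ht' : IsTree L Y b
    · rw [h2 b ht', mul_zero]
    · have hbK : cOf L (b.1 : Fin d → ℤ) b.2 ∈ K := by
        by_contra h
        exact (Finset.mem_compl.1 hb) (mem_freeB.2 ⟨h, ht'⟩)
      have hm : mult L (cOf L (p.1 : Fin d → ℤ) p.2) (b.1 : Fin d → ℤ) b.2 = 0 := by
        by_contra hm
        have e := cOf_eq_of_mult_ne_zero hL hcL (hK _ hbK).1 hm
        obtain ⟨e1, e2⟩ := eq_of_cOf_eq e
        rw [pivSite_cOf] at e1
        exact hbp (Prod.ext (Subtype.ext e1) (e2.trans (cOf_snd _ _)))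
      rw [hm, Nat.cast_zero, zero_mul]

end Elimination

/-! ## §5  The locality constants of C, the packaging, and the p. 250 sentence as a theorem -/

section Locality

open B6Elimination

variable {d : ℕ} {L : ℕ} {Ω : Finset (Fin d → ℤ)} {K : Finset ((Fin d → ℤ) × Fin d)} {Y : Finset (Fin d → ℤ)}

/-- KERNEL-CHECKED, the second inequality of (2.157), printed *"(γ₀/12d²)L^{−d−1}‖CB′‖² ≥ γ′₀‖B′‖², (2.157) where
γ′₀ = (γ₀/12d²)L^{−d−1}"*, i.e. ‖CB′‖² ≥ ‖B′‖²: B′ are some of the coordinates of CB′ (`elimB_mulVec_free`).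
[cite: Balaban1984PropagatorsII, (2.157) p.250] -/
theorem elimB_iso (w : freeB L Ω K Y → ℝ) : ∑ f, w f ^ 2 ≤ ∑ p, (elimB L Ω K Y *ᵥ w) p ^ 2 := by
  calc ∑ f, w f ^ 2 = ∑ f : freeB L Ω K Y, (elimB L Ω K Y *ᵥ w) (f : B4.Idx Ω d) ^ 2 :=
        Finset.sum_congr rfl fun f _ => by rw [elimB_mulVec_free]
    _ = ∑ p ∈ freeB L Ω K Y, (elimB L Ω K Y *ᵥ w) p ^ 2 :=
        Finset.sum_coe_sort (freeB L Ω K Y) (fun p => (elimB L Ω K Y *ᵥ w) p ^ 2)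
    _ ≤ ∑ p, (elimB L Ω K Y *ᵥ w) p ^ 2 :=
        Finset.sum_le_univ_sum_of_nonneg fun p => sq_nonneg _

/-- KERNEL-CHECKED RANGE of C (p. 250 *"C is a short-ranged operator"*, the number not displayed): C(b, b′) ≠ 0 ⇒
|b₋ − b′₋|_∞ ≤ L − 1. [cite: Balaban1984PropagatorsII, p.250] -/
theorem elimB_range (hL : 0 < L) (p : B4.Idx Ω d) (f : freeB L Ω K Y) (h : elimB L Ω K Y p f ≠ 0) :
    dist (p.1 : Fin d → ℤ) ((f : B4.Idx Ω d).1 : Fin d → ℤ) ≤ (L : ℝ) - 1 := by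
  simp only [elimB, Matrix.of_apply] at h
  by_cases h1 : p = (f : B4.Idx Ω d)
  · rw [h1, dist_self]
    have hL1 : (1 : ℝ) ≤ L := by exact_mod_cast hL
    linarith
  rw [if_neg h1] at h
  by_cases h2 : IsTree L Y p ∨ cOf L (p.1 : Fin d → ℤ) p.2 ∉ K
  · rw [if_pos h2] at h
    exact absurd rfl h
  rw [if_neg h2] at h
  have hm : mult L (cOf L (p.1 : Fin d → ℤ) p.2) ((f : B4.Idx Ω d).1 : Fin d → ℤ) (f : B4.Idx Ω d).2 ≠ 0 := by
    intro h0
    apply h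
    rw [h0, Nat.cast_zero, zero_div, neg_zero]
  have h3 := dist_le_of_mult_ne_zero hL hm
  rwa [pivSite_cOf] at h3

/-- At most one variable is the pivot of a given bond c of the L-lattice. [folklore] -/
theorem sum_ite_cOf_le (c : (Fin d → ℤ) × Fin d) {a : ℝ} (ha : 0 ≤ a) :
    ∑ p : B4.Idx Ω d, (if cOf L (p.1 : Fin d → ℤ) p.2 = c then a else 0) ≤ a := by
  rw [← Finset.sum_filter, Finset.sum_const, nsmul_eq_mul]
  have hcard : (Finset.univ.filter fun p : B4.Idx Ω d => cOf L (p.1 : Fin d → ℤ) p.2 = c).card ≤ 1 := by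
    refine Finset.card_le_one.2 fun p hp p' hp' => ?_
    simp only [Finset.mem_filter, Finset.mem_univ, true_and] at hp hp'
    obtain ⟨e1, e2⟩ := eq_of_cOf_eq hp
    obtain ⟨e1', e2'⟩ := eq_of_cOf_eq hp'
    exact Prod.ext (Subtype.ext (e1.trans e1'.symm)) (e2.trans e2'.symm)
  exact mul_le_of_le_one_left ha (by exact_mod_cast hcard)

/-- KERNEL-CHECKED COLUMN SUMS of C: Σ_b |C(b, b′)| ≤ 2 (1 for b = b′, and at most L·(1/L) from the pivots of the
constraints in which b′ occurs, by `sum_mult_le_L`). [cite: Balaban1984PropagatorsII, p.250] -/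
theorem elimB_col (hL : 0 < L) (hKc : ∀ c ∈ K, ∀ i, (L : ℤ) ∣ c.1 i) (f : freeB L Ω K Y) :
    ∑ p, |elimB L Ω K Y p f| ≤ 2 := by
  have hLr : (0 : ℝ) < L := by exact_mod_cast hL
  have hpt : ∀ p : B4.Idx Ω d, |elimB L Ω K Y p f| ≤
      (if p = (f : B4.Idx Ω d) then 1 else 0) +
        ∑ c ∈ K, (if cOf L (p.1 : Fin d → ℤ) p.2 = c then
          (mult L c ((f : B4.Idx Ω d).1 : Fin d → ℤ) (f : B4.Idx Ω d).2 : ℝ) / L else 0) := by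
    intro p
    have hS : 0 ≤ ∑ c ∈ K, (if cOf L (p.1 : Fin d → ℤ) p.2 = c then
        (mult L c ((f : B4.Idx Ω d).1 : Fin d → ℤ) (f : B4.Idx Ω d).2 : ℝ) / L else 0) :=
      Finset.sum_nonneg fun c _ => by split_ifs <;> positivity
    simp only [elimB, Matrix.of_apply]
    by_cases h1 : p = (f : B4.Idx Ω d)
    · rw [if_pos h1, if_pos h1, abs_one]
      linarith
    rw [if_neg h1, if_neg h1, zero_add]
    by_cases h2 : IsTree L Y p ∨ cOf L (p.1 : Fin d → ℤ) p.2 ∉ K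
    · rw [if_pos h2, abs_zero]
      exact hS
    rw [if_neg h2]
    have hK : cOf L (p.1 : Fin d → ℤ) p.2 ∈ K := by
      by_contra h
      exact h2 (Or.inr h)
    rw [Finset.sum_ite_eq K (cOf L (p.1 : Fin d → ℤ) p.2), if_pos hK, abs_neg, abs_div,
      Nat.abs_cast, abs_of_pos hLr]
  calc ∑ p, |elimB L Ω K Y p f|
      ≤ ∑ p : B4.Idx Ω d, ((if p = (f : B4.Idx Ω d) then (1 : ℝ) else 0) +
          ∑ c ∈ K, (if cOf L (p.1 : Fin d → ℤ) p.2 = c then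
            (mult L c ((f : B4.Idx Ω d).1 : Fin d → ℤ) (f : B4.Idx Ω d).2 : ℝ) / L else 0)) :=
        Finset.sum_le_sum fun p _ => hpt p
    _ = 1 + ∑ c ∈ K, ∑ p : B4.Idx Ω d, (if cOf L (p.1 : Fin d → ℤ) p.2 = c then
            (mult L c ((f : B4.Idx Ω d).1 : Fin d → ℤ) (f : B4.Idx Ω d).2 : ℝ) / L else 0) := by
        rw [Finset.sum_add_distrib, Finset.sum_ite_eq' Finset.univ (f : B4.Idx Ω d), if_pos (Finset.mem_univ _),
          Finset.sum_comm]
    _ ≤ 1 + ∑ c ∈ K, (mult L c ((f : B4.Idx Ω d).1 : Fin d → ℤ) (f : B4.Idx Ω d).2 : ℝ) / L := by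
        gcongr with c hc
        exact sum_ite_cOf_le c (by positivity)
    _ = 1 + (∑ c ∈ K, (mult L c ((f : B4.Idx Ω d).1 : Fin d → ℤ) (f : B4.Idx Ω d).2 : ℝ)) / L := by
        rw [Finset.sum_div]
    _ ≤ 1 + 1 := by
        gcongr
        rw [div_le_one hLr]
        exact_mod_cast sum_mult_le_L hL hKc _ _
    _ = 2 := by norm_num

/-- KERNEL-CHECKED ROW SUMS of C: Σ_{b′} |C(b, b′)| ≤ L^d (a pivot row carries the multiplicities of (QB)(c) divided by
L, total ≤ L^d·L/L by `sum_mult_le`; other rows have one or no entry). [cite: Balaban1984PropagatorsII, p.250] -/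
theorem elimB_row (hL : 0 < L) (p : B4.Idx Ω d) : ∑ f, |elimB L Ω K Y p f| ≤ (L : ℝ) ^ d := by
  have hLr : (0 : ℝ) < L := by exact_mod_cast hL
  have hL1 : (1 : ℝ) ≤ (L : ℝ) ^ d := one_le_pow₀ (by exact_mod_cast hL)
  by_cases hp : p ∈ freeB L Ω K Y
  · have h1 : ∀ f : freeB L Ω K Y, |elimB L Ω K Y p f| = if f = ⟨p, hp⟩ then 1 else 0 := by
      intro f
      simp only [elimB, Matrix.of_apply]
      by_cases hf : f = ⟨p, hp⟩
      · rw [if_pos hf, hf, if_pos rfl, abs_one]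
      · have hne : p ≠ (f : B4.Idx Ω d) := fun h => hf (Subtype.ext h.symm)
        rw [if_neg hne, if_pos (Or.inr (mem_freeB.1 hp).1), if_neg hf, abs_zero]
    rw [Finset.sum_congr rfl fun f _ => h1 f, Finset.sum_ite_eq' Finset.univ (⟨p, hp⟩ : freeB L Ω K Y),
      if_pos (Finset.mem_univ _)]
    exact hL1
  by_cases ht : IsTree L Y p
  · have h1 : ∀ f : freeB L Ω K Y, |elimB L Ω K Y p f| = 0 := by
      intro f
      simp only [elimB, Matrix.of_apply]
      have hne : p ≠ (f : B4.Idx Ω d) := fun h => (mem_freeB.1 (h ▸ f.2)).2 ht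
      rw [if_neg hne, if_pos (Or.inl ht), abs_zero]
    rw [Finset.sum_congr rfl fun f _ => h1 f, Finset.sum_const_zero]
    positivity
  have hK : cOf L (p.1 : Fin d → ℤ) p.2 ∈ K := by
    by_contra h
    exact hp (mem_freeB.2 ⟨h, ht⟩)
  have h1 : ∀ f : freeB L Ω K Y, |elimB L Ω K Y p f| =
      (mult L (cOf L (p.1 : Fin d → ℤ) p.2) ((f : B4.Idx Ω d).1 : Fin d → ℤ) (f : B4.Idx Ω d).2 : ℝ) / L := by
    intro f
    simp only [elimB, Matrix.of_apply]
    have hne : p ≠ (f : B4.Idx Ω d) := fun h => (mem_freeB.1 (h ▸ f.2)).1 hK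
    have hno : ¬ (IsTree L Y p ∨ cOf L (p.1 : Fin d → ℤ) p.2 ∉ K) :=
      fun h => h.elim ht (fun h' => h' hK)
    rw [if_neg hne, if_neg hno, abs_neg, abs_div, Nat.abs_cast, abs_of_pos hLr]
  rw [Finset.sum_congr rfl fun f _ => h1 f, ← Finset.sum_div, div_le_iff₀ hLr]
  calc ∑ f : freeB L Ω K Y,
        (mult L (cOf L (p.1 : Fin d → ℤ) p.2) ((f : B4.Idx Ω d).1 : Fin d → ℤ) (f : B4.Idx Ω d).2 : ℝ)
      = ∑ b ∈ freeB L Ω K Y, (mult L (cOf L (p.1 : Fin d → ℤ) p.2) (b.1 : Fin d → ℤ) b.2 : ℝ) :=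
        Finset.sum_coe_sort (freeB L Ω K Y)
          (fun b : B4.Idx Ω d => (mult L (cOf L (p.1 : Fin d → ℤ) p.2) (b.1 : Fin d → ℤ) b.2 : ℝ))
    _ ≤ ∑ b : B4.Idx Ω d, (mult L (cOf L (p.1 : Fin d → ℤ) p.2) (b.1 : Fin d → ℤ) b.2 : ℝ) :=
        Finset.sum_le_univ_sum_of_nonneg fun b => Nat.cast_nonneg _
    _ ≤ (L : ℝ) ^ d * L := by
        exact_mod_cast sum_mult_le (Ω := Ω) (cOf L (p.1 : Fin d → ℤ) p.2)

/-- The HYPOTHESIS (2.153) on Δ = Δ_k (per k; NOT proved here — B6 derives it from (2.118) and Lemma 2.4 (2.128)):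
*"⟨B, Δ_kB⟩ ≥ (γ₀/12d²)L^{−d−1}‖B‖², or Δ_k ≥ (γ₀/12d²)L^{−d−1} (2.153) on the subspace of B satisfying: QB = 0,
B(Γ_{y,x}) = 0 for x ∈ B(y)"* — typed with the constant as a parameter γ, the constraints as (QB)(c) = 0, c ∈ K, and
B = 0 on the tree bonds. [cite: Balaban1984PropagatorsII, (2.153) p.249] -/
def LowerOnConstrained (L : ℕ) (K : Finset ((Fin d → ℤ) × Fin d)) (Y : Finset (Fin d → ℤ))
    (Δ : Matrix (B4.Idx Ω d) (B4.Idx Ω d) ℝ) (γ : ℝ) : Prop :=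
  ∀ B : B4.Idx Ω d → ℝ, (∀ c ∈ K, avgQ L B c = 0) → (∀ p, IsTree L Y p → B p = 0) →
    γ * ∑ p, B p ^ 2 ≤ ∑ p, B p * (Δ *ᵥ B) p

variable (L Ω K Y)

/-- The instance of the scheme at (S5): variables = the unit bonds starting in Ω (N = d components per site by B5
(1.1)), kept variables = `freeB`, C = `elimB`, covariance `SubReduction.cov` = C(C*ΔC)⁻¹C* of (2.156).
[cite: Balaban1984PropagatorsII, (2.156) p.250] -/
def bondReduction (Δ : Matrix (B4.Idx Ω d) (B4.Idx Ω d) ℝ) : SubReduction d d :=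
  ⟨Ω, freeB L Ω K Y, Δ, elimB L Ω K Y⟩

variable {L Ω K Y}

/-- KERNEL-CHECKED: admissible constraint data, Δ symmetric with entry decay (c₀, δ₀) and the lower bound (2.153)
with constant γ on {QB = 0, B(Γ_{y,x}) = 0} give the printed-shape inputs with range L − 1 and ℓ¹ sums ≤ L^d + 1 —
the first inequality of (2.157) *"⟨B′, C*Δ_kCB′⟩ ≥ (γ₀/12d²)L^{−d−1}‖CB′‖²"* being (2.153) applied to B = CB′, which
lies in the constrained subspace by `avgQ_elimB_mulVec` and `elimB_mulVec_tree`.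
[cite: Balaban1984PropagatorsII, (2.153)–(2.157) pp.249–250] -/
theorem bondReduction_printed (hL : 0 < L) (hK : Admissible L Ω K) {Δ : Matrix (B4.Idx Ω d) (B4.Idx Ω d) ℝ}
    {γ c₀ δ₀ : ℝ} (hs : Δ.IsSymm)
    (hd : ∀ p q : B4.Idx Ω d, |Δ p q| ≤ c₀ * Real.exp (-(δ₀ * dist (p.1 : Fin d → ℤ) (q.1 : Fin d → ℤ))))
    (hl : LowerOnConstrained L K Y Δ γ) :
    (bondReduction L Ω K Y Δ).Printed γ c₀ δ₀ ((L : ℝ) - 1) ((L : ℝ) ^ d + 1) where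
  symm := hs
  decay := hd
  lower w := hl _ (fun c hc => avgQ_elimB_mulVec hL hK w hc) (fun p hp => elimB_mulVec_tree w hp)
  iso w := elimB_iso w
  range p k h := elimB_range hL p k h
  col k := (elimB_col hL (fun c hc => (hK c hc).1) k).trans (by
    have h1 : (1 : ℝ) ≤ (L : ℝ) ^ d := one_le_pow₀ (by exact_mod_cast hL)
    linarith)
  row p := (elimB_row hL p).trans (by linarith)

/-- KERNEL-CHECKED — the sentence of p. 250 as a theorem, modulo the named leaves: *"C is a short-ranged operator, so
C*Δ_kC has the same exponential decay as Δ_k. Now we may apply the theory developed in Sect. 5 of [3] on unit lattice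
operators. It gives us an exponential decay, and all the other properties, for the operator (C*Δ_kC)⁻¹, hence for
C^{(k)}_Λ also."*  From `B4.Sect5ThmUniform d d` (the theorem of [3], uniform reading, fibre R^d, consumed as a
hypothesis) there are ONE c and ONE δ — chosen after (d, L, γ, c₀, δ₀) and BEFORE the region, the constraint data and
the operator — such that for EVERY finite Ω ⊂ Z^d, EVERY admissible (K, Y) and EVERY symmetric Δ on the bond variables
of Ω with |Δ(b, b′)| ≤ c₀e^{−δ₀|b₋−b′₋|} and (2.153) with constant γ on {QB = 0, B(Γ_{y,x}) = 0}, the covariance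
C^{(k)}_Λ = C(C*Δ_kC)⁻¹C* of (2.156) satisfies |C^{(k)}_Λ(b, b′)| ≤ c·e^{−δ|b₋−b′₋|} (k-independence = the quantifier
order ∃(c, δ) ∀(Ω, K, Y, Δ_k)). Chain: `bondReduction_printed` → `subReductions_uniform`.
[cite: Balaban1984PropagatorsII, (2.153)–(2.157) pp.249–250] -/
theorem bond250_uniform (h5 : B4.Sect5ThmUniform d d) (hL : 0 < L) {γ c₀ δ₀ : ℝ} (hγ : 0 < γ)
    (hc : 0 < c₀) (hδ : 0 < δ₀) :
    ∃ c δ : ℝ, 0 < c ∧ 0 < δ ∧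
      ∀ (Ω : Finset (Fin d → ℤ)) (K : Finset ((Fin d → ℤ) × Fin d)) (Y : Finset (Fin d → ℤ)),
        Admissible L Ω K → ∀ Δ : Matrix (B4.Idx Ω d) (B4.Idx Ω d) ℝ, Δ.IsSymm →
        (∀ p q : B4.Idx Ω d, |Δ p q| ≤ c₀ * Real.exp (-(δ₀ * dist (p.1 : Fin d → ℤ) (q.1 : Fin d → ℤ)))) →
        LowerOnConstrained L K Y Δ γ →
        ∀ p q : B4.Idx Ω d, |(bondReduction L Ω K Y Δ).cov p q| ≤
          c * Real.exp (-(δ * dist (p.1 : Fin d → ℤ) (q.1 : Fin d → ℤ))) := by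
  have hm : (0 : ℝ) < (L : ℝ) ^ d + 1 := by positivity
  obtain ⟨c, δ, hc', hδ', H⟩ := subReductions_uniform h5 (r := (L : ℝ) - 1) hγ hc hδ hm
  exact ⟨c, δ, hc', hδ', fun Ω K Y hK Δ hs hd hl p q =>
    H (bondReduction L Ω K Y Δ) (bondReduction_printed hL hK hs hd hl) p q⟩

/-- The covariance of the instance is literally (2.156): C(C*ΔC)⁻¹C* with C = `elimB`. [cite: Balaban1984PropagatorsII,
(2.156) p.250] -/
theorem bondReduction_cov (Δ : Matrix (B4.Idx Ω d) (B4.Idx Ω d) ℝ) :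
    (bondReduction L Ω K Y Δ).cov =
      elimB L Ω K Y * ((elimB L Ω K Y)ᵀ * Δ * elimB L Ω K Y)⁻¹ * (elimB L Ω K Y)ᵀ := rfl

end Locality


end

end Literature.MathematicalPhysics.QuantumFieldTheory.Balaban1983to89.B6BondElimination
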